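import Literature.AlgebraicGeometry.Shioda1982.HodgeQuadruplesTwoThreePower
import HarnessLib

/-!
# Hodge quadruples of the Fermat surface at the levels `m = 3·2ᵃ`: the third relation, twin or `γ`

Topic `Literature/AlgebraicGeometry/Shioda1982`. THEOREMS only (no definition of record, no named fact, no `sorry`).
Fifth file of the series treating [Aoki1983, Thm. C] = [AokiShioda1983, Thm. (𝔅²ₘ) (ii)] = [Shioda1982PicardFermat,
Prop. 4 (Q′)] at the levels `m = 2ᵃ3ᵇ` without a prime factor `≥ 5` (parts I–IV: `HodgeQuadruplesTwoThreePower`, `…Step`,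
`…Mixed`, `StandardQuadrupleTwoThreePower` treat `a, b ≥ 2` given the two EDGE families `2·3ᵇ` and `3·2ᵃ`). This file and
`StandardQuadrupleTwoPowThree` settle the edge family **`b = 1`, `m = 3·2ᵃ`**, where the hexagon relation of part I fails
(`9 ∤ m`: of the class `{y, y + 2n, y + 4n}` of a unit `y` modulo `2n = m/3` exactly ONE member is divisible by `3`).

Write `m = 6n`, `n = 2ⁱ` (`i = a − 1`), `𝔥 = 3n = m/2`, `𝔯 = 2n = m/3`; `o(w) = #_w s − #_{−w} s`, `d(w) = o(w) − o(w + 𝔥)`,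
`Φ_y(g) = g(y) − g(−y) − g(y + 𝔥) + g(−(y + 𝔥))` as in part I.

* **`countSub_third_twoPowThree`** (the THIRD RELATION, `i ≥ 1`): for a Hodge multiset `s`, an odd `x` divisible by `3`, a unit
  `u₁ ≡ x (mod 2n)` and a unit `u₂` with `3u₂ = x`: **`d(x) − d(u₁) + d(u₂) = 0`**. PROOF: the functional `Φ_x − Φ_{u₁} + Φ_{u₂}`
  kills every Koblitz–Ogus vector `D_{M,z} = 𝟙_{≡ z (M)} − e_{(m/M)z}`: a divisor `M` of `3·2ᵃ` divides `3n` (every `Φ` kills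
  the congruence part, the point is even, the twelve points odd), or `M = 2n` (the congruence parts of `Φ_x`, `Φ_{u₁}` agree,
  `Φ_{u₁}`, `Φ_{u₂}` do not see the point `3z`, and `Φ_x` sees it exactly as `Φ_{u₂}` sees the class of `z`: `3z = 3t ⟺ z ≡ t
  (mod 2n)`), or `M = m`. Together with part I's class relation `countSub_class_twoThreePower` (`d(y) = d(y′)` for units
  `y ≡ y′ (mod 2n)`, valid at `b = 1`) this replaces the hexagon.
* **`twin_or_gamma_twoPowThree`** (`i ≥ 4`, i.e. `m ≥ 96`): in a PAIR-FREE Hodge `4`-multiset `s` over `ℤ/3·2ᵃ` a unit member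
  `y` is TWINNED (`#_{y + 𝔥} = #_y`) or `s = γ_y = {y, y + 2n, y + 4n, −3y}`. PROOF: let `y′` be the unit and `x` the multiple of
  `3` among `y + 2n, y + 4n`, and `u` a unit third of `x`. If `d(u) = 0` the third relation restores both hexagon identities and
  part I's count arithmetic applies verbatim. If `d(u) ≠ 0`, CHARGE PROPAGATES: `d(y′) = d(y) ≠ 0`, `d(u′) = d(u) ≠ 0` put a
  member of `s` in each of the groups `{±w, ±(w + 𝔥)}` of `y′, u, u′`, besides `y` — four distinct members (the hexagons
  `±y + nℤ`, `±u + nℤ` are disjoint: `3u ≡ y (mod n)` and `y` odd), so the group of the multiple of `3` in the class of `u` is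
  empty and the third relation there charges a unit third `v` of it (`9v ≡ y (mod n)`), a fifth member.
* **`shape_of_twin_twoPowThree`**: in the twinned case `s = {y, y + 𝔥, z, w}`, `z + w = −(2y + 𝔥)`, `z, w` even and not both
  divisible by `3` — the input of the twin transfer of part II (`twin_transfer`, branch `4 ∣ N`).

Cross-checks outside Lean (cell `pub-hfermat`, `g39-session/towers/edge/`): brute force over all Hodge `4`-multisets at
`m = 24, 48, 96, 192` (`146, 416, 1356, 4964` multisets): the third relation holds for every odd multiple of `3` and every
admissible `u₁, u₂` (`0` violations in `184456` instances), the class relation holds (`0` violations); at `96, 192` every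
indecomposable quadruple has `0` or `2` unit members, a unit member is twinned with even partners or sits in a `γ`, no
unit-free indecomposable is mixed, and the non-standard indecomposables are the `62` lifts of the exceptional quadruples of
levels `12, 24, 48` ([MeyerNeutsch1981Fermatquadrupel, Tabelle 1]).

HONEST FRAMING (cell `pub-hfermat`): explicit algebraic cycles for specific Hodge classes on Fermat/Delsarte varieties; residual
open instances listed; no claim on general Hodge. (Surface classes are algebraic by Lefschetz (1,1); this file proves count
identities for Shioda's Hodge condition towards a printed structure theorem; no cycle is constructed here.)

## References
* [Aoki1983] N. Aoki, *On some arithmetic problems related to the Hodge cycles on the Fermat varieties*, Math. Ann. 266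
  (1983) 23–54 — Thm. C p. 47, Prop. 2.2 (level change), Thm. D.
* [AokiShioda1983] N. Aoki, T. Shioda, *Generators of the Néron–Severi group of a Fermat surface*, Progr. Math. 35 (1983)
  1–12 — §2 Thm. (𝔅²ₘ) (ii).
* [Shioda1982PicardFermat] T. Shioda, *On the Picard number of a Fermat surface*, J. Fac. Sci. Univ. Tokyo IA 28 (1982)
  725–734 — Lemma 1, Prop. 4 (Q′) p. 729.
* [Deligne1982HodgeCycles] P. Deligne, *Hodge cycles on abelian varieties*, LNM 900 (1982), Rem. 7.16 (a) (Koblitz–Ogus);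
  through the tree's `KoblitzOgus.hodge_eq_combination`.
* [MeyerNeutsch1981Fermatquadrupel] W. Meyer, W. Neutsch, *Fermatquadrupel*, Math. Ann. 256 (1981) 51–62 — Tabelle 1 p. 54.
* [Shioda1979PJA] T. Shioda, Proc. Japan Acad. 55A (1979) 111–114, §1 (2), (3) (the Hodge condition `IsHodgeMultiset`).
-/

namespace Literature.AlgebraicGeometry.Shioda1982

open Finset Multiset
open Literature.AlgebraicGeometry.HodgeTheory Literature.AlgebraicGeometry.HodgeTheory.FermatCharacter

section TwoPowThree

variable {m n i : ℕ} [NeZero m]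

/-- `𝔥 = 3n = m/2` as a residue modulo `m = 6n`. -/
local notation "𝔥" => (((3 * n : ℕ)) : ZMod m)
/-- `𝔯 = 2n = m/3` as a residue modulo `m = 6n`. -/
local notation "𝔯" => (((2 * n : ℕ)) : ZMod m)
/-- `𝔫 = n = m/6` as a residue modulo `m = 6n`. -/
local notation "𝔫" => (((n : ℕ)) : ZMod m)
/-- `d(w) = o(w) − o(w + 3n)`, `o(w) = #_w s − #_{−w} s`, the charge of the group `{±w, ±(w + 3n)}` in `s`. -/
local notation "𝔡[" s ", " w "]" =>
  (((Multiset.count w s : ℤ) - Multiset.count (-w) s) - ((Multiset.count (w + 𝔥) s : ℤ) - Multiset.count (-(w + 𝔥)) s))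

/-! ### The level `m = 6n = 3·2ⁱ⁺¹`: elementary facts -/

omit [NeZero m] in
/-- `n = 2ⁱ·3⁰` (to quote part I). [folklore] -/
private theorem hn₅ (hn : n = 2 ^ i) : n = 2 ^ i * 3 ^ 0 := by
  rw [hn, pow_zero, mul_one]

omit [NeZero m] in
/-- `0 < n`. [folklore] -/
private theorem n_pos₅ (hn : n = 2 ^ i) : 0 < n := by
  rw [hn]; positivity

omit [NeZero m] in
/-- `2 ∣ n` when `i ≥ 1`. [folklore] -/
private theorem two_dvd_n₅ (hn : n = 2 ^ i) (hi : 1 ≤ i) : 2 ∣ n := by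
  obtain ⟨i', rfl⟩ := Nat.exists_eq_add_of_le' hi
  exact ⟨2 ^ i', by rw [hn]; ring⟩

omit [NeZero m] in
/-- `8 ∣ n` when `i ≥ 3`. [folklore] -/
private theorem eight_dvd_n₅ (hn : n = 2 ^ i) (hi : 3 ≤ i) : 8 ∣ n := by
  obtain ⟨i', rfl⟩ := Nat.exists_eq_add_of_le' hi
  exact ⟨2 ^ i', by rw [hn]; ring⟩

omit [NeZero m] in
/-- `16 ∣ n` when `i ≥ 4`. [folklore] -/
private theorem sixteen_dvd_n₅ (hn : n = 2 ^ i) (hi : 4 ≤ i) : 16 ∣ n := by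
  obtain ⟨i', rfl⟩ := Nat.exists_eq_add_of_le' hi
  exact ⟨2 ^ i', by rw [hn]; ring⟩

omit [NeZero m] in
/-- `3 ∤ n`. [folklore] -/
private theorem not_three_dvd_n₅ (hn : n = 2 ^ i) : ¬ 3 ∣ n := by
  rw [hn]
  intro h
  have := (Nat.Prime.dvd_of_dvd_pow Nat.prime_three h)
  omega

omit [NeZero m] in
/-- `3n + 3n = 0` in `ℤ/6n`. [folklore] -/
private theorem h_add_h₅ (hm : m = 6 * n) : 𝔥 + 𝔥 = 0 := by
  have e : (((3 * n : ℕ) : ZMod m)) + ((3 * n : ℕ) : ZMod m) = ((m : ℕ) : ZMod m) := by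
    push_cast; rw [hm]; push_cast; ring
  rw [e, ZMod.natCast_self]

omit [NeZero m] in
/-- `−3n = 3n`. [folklore] -/
private theorem neg_h₅ (hm : m = 6 * n) : -𝔥 = 𝔥 := by
  linear_combination -(h_add_h₅ hm)

omit [NeZero m] in
/-- `−(y + 3n) = −y + 3n`. [folklore] -/
private theorem neg_add_h₅ (hm : m = 6 * n) (y : ZMod m) : -(y + 𝔥) = -y + 𝔥 := by
  rw [neg_add, neg_h₅ hm]

omit [NeZero m] in
/-- `⟨3n⟩ = 3n`. [folklore] -/
private theorem val_h₅ (hm : m = 6 * n) (hn0 : 0 < n) : (𝔥 : ZMod m).val = 3 * n := by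
  rw [ZMod.val_natCast, Nat.mod_eq_of_lt (by omega)]

omit [NeZero m] in
/-- `⟨2n⟩ = 2n`. [folklore] -/
private theorem val_r₅ (hm : m = 6 * n) (hn0 : 0 < n) : (𝔯 : ZMod m).val = 2 * n := by
  rw [ZMod.val_natCast, Nat.mod_eq_of_lt (by omega)]

omit [NeZero m] in
/-- `3n = 3·n`, `2n = 2·n` as residues. [folklore] -/
private theorem h_eq_three_mul₅ : (𝔥 : ZMod m) = 3 * 𝔫 ∧ (𝔯 : ZMod m) = 2 * 𝔫 := by
  constructor <;> push_cast <;> ring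

omit [NeZero m] in
/-- `6·n = 0` in `ℤ/6n`. [folklore] -/
private theorem six_mul_n₅ (hm : m = 6 * n) : (6 : ZMod m) * 𝔫 = 0 := by
  have e : (6 : ZMod m) * ((n : ℕ) : ZMod m) = ((m : ℕ) : ZMod m) := by rw [hm]; push_cast; ring
  rw [e, ZMod.natCast_self]

/-- Adding a multiple of `M` does not change the residue mod `M` (`M ∣ m`). [folklore] -/
private theorem mod_add_of_dvd₅ {M : ℕ} (hM : M ∣ m) (x : ZMod m) {c : ZMod m} (hc : M ∣ c.val) :
    (x + c).val % M = x.val % M := by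
  obtain ⟨t, ht⟩ := hc
  rw [ZMod.val_add, Nat.mod_mod_of_dvd _ hM, ht, Nat.add_mul_mod_self_left]

/-- `x ≡ x' (mod M)` is stable under adding a constant (`M ∣ m`). [folklore] -/
private theorem mod_congr_add₅ {M : ℕ} (hM : M ∣ m) {x x' : ZMod m} (h : x.val % M = x'.val % M) (c : ZMod m) :
    (x + c).val % M = (x' + c).val % M := by
  rw [ZMod.val_add, ZMod.val_add, Nat.mod_mod_of_dvd _ hM, Nat.mod_mod_of_dvd _ hM, Nat.add_mod, h, ← Nat.add_mod]

/-- `x ≡ x' (mod M)` iff the reductions mod `M` agree. [folklore] -/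
private theorem castHom_eq_iff₅ {M : ℕ} (hM : M ∣ m) {x x' : ZMod m} :
    (ZMod.castHom hM (ZMod M)) x = (ZMod.castHom hM (ZMod M)) x' ↔ x.val % M = x'.val % M := by
  rw [ZMod.castHom_apply, ZMod.castHom_apply, ZMod.cast_eq_val, ZMod.cast_eq_val, ZMod.natCast_eq_natCast_iff']

/-- `x ≡ x' (mod M)` is stable under negation (`M ∣ m`). [folklore] -/
private theorem mod_congr_neg₅ {M : ℕ} (hM : M ∣ m) {x x' : ZMod m} (h : x.val % M = x'.val % M) :
    (-x).val % M = (-x').val % M := by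
  rw [← castHom_eq_iff₅ hM] at h ⊢
  rw [map_neg, map_neg, h]

/-- `p ∣ ⟨x⟩` iff `x` reduces to `0` modulo `p` (`p ∣ m`). [folklore] -/
private theorem dvd_val_iff_cast₅ {p : ℕ} (hp : p ∣ m) (x : ZMod m) : p ∣ x.val ↔ ZMod.castHom hp (ZMod p) x = 0 := by
  rw [ZMod.castHom_apply, ZMod.cast_eq_val, ZMod.natCast_eq_zero_iff]

/-- A divisor `p` of `m` divides `⟨−x⟩` iff it divides `⟨x⟩`. [folklore] -/
private theorem dvd_val_neg_iff₅ {p : ℕ} (hp : p ∣ m) (x : ZMod m) : p ∣ (-x).val ↔ p ∣ x.val := by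
  rw [dvd_val_iff_cast₅ hp, dvd_val_iff_cast₅ hp, map_neg, neg_eq_zero]

/-- A divisor `p` of `m` dividing `⟨c⟩` divides `⟨x + c⟩` iff it divides `⟨x⟩`. [folklore] -/
private theorem dvd_val_add_iff₅ {p : ℕ} (hp : p ∣ m) (x : ZMod m) {c : ZMod m} (hc : p ∣ c.val) :
    p ∣ (x + c).val ↔ p ∣ x.val := by
  rw [Nat.dvd_iff_mod_eq_zero, Nat.dvd_iff_mod_eq_zero, mod_add_of_dvd₅ hp x hc]

omit [NeZero m] in
/-- `2 ∣ m`. [folklore] -/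
private theorem two_dvd_m₅ (hm : m = 6 * n) : 2 ∣ m := ⟨3 * n, by rw [hm]; ring⟩

omit [NeZero m] in
/-- `3 ∣ m`. [folklore] -/
private theorem three_dvd_m₅ (hm : m = 6 * n) : 3 ∣ m := ⟨2 * n, by rw [hm]; ring⟩

omit [NeZero m] in
/-- `8 ∣ m` when `i ≥ 2`. [folklore] -/
private theorem eight_dvd_m₅ (hm : m = 6 * n) (hn : n = 2 ^ i) (hi : 2 ≤ i) : 8 ∣ m := by
  obtain ⟨i', rfl⟩ := Nat.exists_eq_add_of_le' hi
  exact ⟨3 * 2 ^ i', by rw [hm, hn]; ring⟩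

/-- The points `−y, y + 3n, −(y + 3n)` attached to an odd `y` are odd (`2 ∣ n`). [folklore] -/
private theorem odd_points₅ (hm : m = 6 * n) (hn0 : 0 < n) (h2 : 2 ∣ n) {y : ZMod m} (hy : ¬ 2 ∣ y.val) :
    ¬ 2 ∣ (-y).val ∧ ¬ 2 ∣ (y + 𝔥).val ∧ ¬ 2 ∣ (-(y + 𝔥)).val := by
  have h2h : 2 ∣ (𝔥 : ZMod m).val := by rw [val_h₅ hm hn0]; exact Dvd.dvd.mul_left h2 3
  have a2 : ¬ 2 ∣ (y + 𝔥).val := by rwa [dvd_val_add_iff₅ (two_dvd_m₅ hm) y h2h]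
  exact ⟨by rwa [dvd_val_neg_iff₅ (two_dvd_m₅ hm)], a2, by rwa [dvd_val_neg_iff₅ (two_dvd_m₅ hm)]⟩

/-- The points `−y, y + 3n, −(y + 3n)` attached to a `y` prime to `3` are prime to `3`. [folklore] -/
private theorem prime_three_points₅ (hm : m = 6 * n) (hn0 : 0 < n) {y : ZMod m} (hy3 : ¬ 3 ∣ y.val) :
    ¬ 3 ∣ (-y).val ∧ ¬ 3 ∣ (y + 𝔥).val ∧ ¬ 3 ∣ (-(y + 𝔥)).val := by
  have h3h : 3 ∣ (𝔥 : ZMod m).val := by rw [val_h₅ hm hn0]; exact Dvd.intro n rfl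
  have a3 : ¬ 3 ∣ (y + 𝔥).val := by rwa [dvd_val_add_iff₅ (three_dvd_m₅ hm) y h3h]
  exact ⟨by rwa [dvd_val_neg_iff₅ (three_dvd_m₅ hm)], a3, by rwa [dvd_val_neg_iff₅ (three_dvd_m₅ hm)]⟩

omit [NeZero m] in
/-- The divisors of `m = 3·2ⁱ⁺¹`: each divides `3n = m/2`, or equals `2n = m/3`, or equals `m`. [folklore] -/
private theorem dvd_cases₅ (hm : m = 6 * n) (hn : n = 2 ^ i) {M : ℕ} (hM : M ∣ m) :
    M ∣ 3 * n ∨ M = 2 * n ∨ M = m := by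
  rw [hm, hn, show 6 * 2 ^ i = 2 ^ (i + 1) * 3 ^ 1 by ring] at hM
  obtain ⟨a, b, ha, hb, rfl⟩ := Nat.dvd_mul.mp hM
  obtain ⟨s, hs, rfl⟩ := (Nat.dvd_prime_pow Nat.prime_two).mp ha
  obtain ⟨t, ht, rfl⟩ := (Nat.dvd_prime_pow Nat.prime_three).mp hb
  by_cases hs' : s ≤ i
  · left
    rw [show 3 * n = 2 ^ i * 3 ^ 1 by rw [hn]; ring]
    exact Nat.mul_dvd_mul (pow_dvd_pow 2 hs') (pow_dvd_pow 3 ht)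
  · have hsi : s = i + 1 := by omega
    subst hsi
    interval_cases t
    · right; left
      rw [hn]; ring
    · right; right
      rw [hm, hn]; ring

/-! ### The four-point functional `Φ_y` and the Koblitz–Ogus vectors (part I's private bridge, restated for this file) -/

variable (n) in
/-- The four-point functional `Φ_y(g) = g(y) − g(−y) − g(y + 3n) + g(−(y + 3n))` on functions on `ℤ/6n`. [folklore] -/
private def phi₅ (y : ZMod m) (g : ZMod m → ℚ) : ℚ :=
  g y - g (-y) - g (y + 𝔥) + g (-(y + 𝔥))

omit [NeZero m] in
/-- `Φ_y` is additive. [folklore] -/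
private theorem phi₅_add (y : ZMod m) (g g' : ZMod m → ℚ) :
    phi₅ n y (fun w ↦ g w + g' w) = phi₅ n y g + phi₅ n y g' := by
  simp only [phi₅]
  ring

omit [NeZero m] in
/-- `Φ_y` is homogeneous. [folklore] -/
private theorem phi₅_mul (y : ZMod m) (c : ℚ) (g : ZMod m → ℚ) :
    phi₅ n y (fun w ↦ c * g w) = c * phi₅ n y g := by
  simp only [phi₅]
  ring

omit [NeZero m] in
/-- `Φ_y` commutes with finite sums. [folklore] -/
private theorem phi₅_sum (y : ZMod m) {ι : Type*} (t : Finset ι) (g : ι → ZMod m → ℚ) :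
    phi₅ n y (fun w ↦ ∑ j ∈ t, g j w) = ∑ j ∈ t, phi₅ n y (g j) := by
  simp only [phi₅, Finset.sum_add_distrib, Finset.sum_sub_distrib]

omit [NeZero m] in
/-- `Φ_y` kills negation-invariant functions. [folklore] -/
private theorem phi₅_eq_zero_of_even (y : ZMod m) {g : ZMod m → ℚ} (hg : ∀ w, g (-w) = g w) :
    phi₅ n y g = 0 := by
  simp only [phi₅, hg]
  ring

/-- The Koblitz–Ogus distribution vector of level `M ∣ m` through `z`: `w ↦ [w ≡ z (mod M)] − [(m/M)·z = w]`.
[cite: Deligne1982HodgeCycles, Rem. 7.16 (a)] -/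
private def koD₅ (m : ℕ) (M : ℕ) (z w : ZMod m) : ℚ :=
  (if w.val % M = z.val % M then (1 : ℚ) else 0) - (if ((m / M : ℕ) : ZMod m) * z = w then 1 else 0)

omit [NeZero m] in
/-- **A point mass at a point with a divisor `p ∣ m` is invisible to `Φ_y`** when the four points of `Φ_y` are prime to `p`.
[folklore] -/
private theorem phi₅_point_dvd {p : ℕ} {y w : ZMod m} (hw : p ∣ w.val) (h₀ : ¬ p ∣ y.val) (h₁ : ¬ p ∣ (-y).val)
    (h₂ : ¬ p ∣ (y + 𝔥).val) (h₃ : ¬ p ∣ (-(y + 𝔥)).val) :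
    phi₅ n y (fun v ↦ if w = v then (1 : ℚ) else 0) = 0 := by
  have ne : ∀ v : ZMod m, ¬ p ∣ v.val → w ≠ v := by
    rintro v hv rfl
    exact hv hw
  simp only [phi₅, if_neg (ne y h₀), if_neg (ne _ h₁), if_neg (ne _ h₂), if_neg (ne _ h₃)]
  ring

/-- The congruence indicator `[· ≡ z (mod M)]` is killed by `Φ_y` for every `M ∣ 3n`. [folklore] -/
private theorem phi₅_congr_eq_zero (hm : m = 6 * n) (hn0 : 0 < n) (y z : ZMod m) {M : ℕ} (hM : M ∣ 3 * n) :
    phi₅ n y (fun v ↦ if v.val % M = z.val % M then (1 : ℚ) else 0) = 0 := by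
  have hMm : M ∣ m := Nat.dvd_trans hM ⟨2, by rw [hm]; ring⟩
  have hc : M ∣ (𝔥 : ZMod m).val := by rw [val_h₅ hm hn0]; exact hM
  have e3 : -(y + 𝔥) = -y + 𝔥 := neg_add_h₅ hm y
  simp only [phi₅, e3, mod_add_of_dvd₅ hMm _ hc]
  ring

/-- The congruence indicator modulo `M ∣ m` is seen by `Φ_y` only through the class of `y` modulo `M`. [folklore] -/
private theorem phi₅_congr_M {M : ℕ} (hM : M ∣ m) {y y' : ZMod m} (hyy' : y.val % M = y'.val % M) (z : ZMod m) :
    phi₅ n y (fun v ↦ if v.val % M = z.val % M then (1 : ℚ) else 0) =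
      phi₅ n y' (fun v ↦ if v.val % M = z.val % M then (1 : ℚ) else 0) := by
  have a1 : (-y).val % M = (-y').val % M := mod_congr_neg₅ hM hyy'
  have a2 : (y + 𝔥).val % M = (y' + 𝔥).val % M := mod_congr_add₅ hM hyy' _
  have a3 : (-(y + 𝔥)).val % M = (-(y' + 𝔥)).val % M := mod_congr_neg₅ hM a2
  simp only [phi₅, hyy', a1, a2, a3]

/-- The distribution vector of level `m` is zero. [folklore] -/
private theorem koD₅_self (z w : ZMod m) : koD₅ m m z w = 0 := by
  have hm0 : m ≠ 0 := NeZero.ne m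
  simp only [koD₅, Nat.mod_eq_of_lt (ZMod.val_lt _), Nat.div_self (Nat.pos_of_ne_zero hm0), Nat.cast_one, one_mul]
  by_cases hzw : w = z
  · rw [if_pos (by rw [hzw]), if_pos hzw.symm, sub_self]
  · rw [if_neg (fun e ↦ hzw (ZMod.val_injective _ e)), if_neg (fun e ↦ hzw e.symm), sub_self]

/-- The point `(m/M)·z` of `D_{M,z}` has `p ∣ ⟨(m/M)z⟩` whenever `M ∣ m/p` (`p ∣ m`). [folklore] -/
private theorem point_dvd₅ {p M : ℕ} (hp : 0 < p) (hpm : p ∣ m) (hM : M ∣ m / p) (hM0 : 0 < M) (z : ZMod m) :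
    p ∣ ((((m / M : ℕ)) : ZMod m) * z).val := by
  obtain ⟨c, hc⟩ := hM
  obtain ⟨e, he⟩ := hpm
  have hmM : m / M = p * c := by
    rw [he, Nat.mul_div_cancel_left _ hp] at hc
    rw [he, hc, show p * (M * c) = M * (p * c) by ring, Nat.mul_div_cancel_left _ hM0]
  rw [hmM, show ((((p * c : ℕ)) : ZMod m)) * z = (((p * (c * z.val) : ℕ)) : ZMod m) by
    push_cast; rw [ZMod.natCast_zmod_val]; ring, ZMod.val_natCast]
  exact (Nat.dvd_mod_iff ⟨e, he⟩).mpr (Dvd.intro _ rfl)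

/-- **`3z = 3t ⟺ z ≡ t (mod 2n)`** in `ℤ/6n`. [folklore] -/
private theorem three_mul_eq_iff₅ (hm : m = 6 * n) (z t : ZMod m) :
    (3 : ZMod m) * z = 3 * t ↔ z.val % (2 * n) = t.val % (2 * n) := by
  have h2n : 2 * n ∣ m := ⟨3, by rw [hm]; ring⟩
  rw [← castHom_eq_iff₅ h2n, ← sub_eq_zero, ← mul_sub, ← sub_eq_zero (a := ZMod.castHom h2n _ z), ← map_sub]
  set w := z - t
  rw [show (3 : ZMod m) * w = (((3 * w.val : ℕ)) : ZMod m) by push_cast; rw [ZMod.natCast_zmod_val],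
    ZMod.natCast_eq_zero_iff, ZMod.castHom_apply, ZMod.cast_eq_val, ZMod.natCast_eq_zero_iff]
  have hm' : 3 * (2 * n) ∣ m := ⟨1, by rw [hm]; ring⟩
  have hm'' : m ∣ 3 * (2 * n) := ⟨1, by rw [hm]; ring⟩
  constructor
  · intro h
    exact (Nat.mul_dvd_mul_iff_left three_pos).mp (dvd_trans hm' h)
  · intro h
    exact dvd_trans hm'' (Nat.mul_dvd_mul_left 3 h)

/-- **The point `3z` is seen by `Φ_x` as the class of `z` modulo `2n` is seen by `Φ_{u₂}`** when `3u₂ = x`: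
`[3z = x] − [3z = −x] − [3z = x + 3n] + [3z = −(x + 3n)] = [u₂ ≡ z] − [−u₂ ≡ z] − [u₂ + 3n ≡ z] + [−(u₂ + 3n) ≡ z] (mod 2n)`
(`x + 3n = 3(u₂ + n)`, `u₂ + 3n ≡ u₂ + n (mod 2n)`). [folklore] -/
private theorem phi₅_point_third (hm : m = 6 * n) (hn0 : 0 < n) {x u₂ : ZMod m} (hxu₂ : 3 * u₂ = x) (z : ZMod m) :
    phi₅ n x (fun v ↦ if (3 : ZMod m) * z = v then (1 : ℚ) else 0) =
      phi₅ n u₂ (fun v ↦ if v.val % (2 * n) = z.val % (2 * n) then (1 : ℚ) else 0) := by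
  have h2n : 2 * n ∣ m := ⟨3, by rw [hm]; ring⟩
  obtain ⟨eh, er⟩ := h_eq_three_mul₅ (m := m) (n := n)
  have hrval : 2 * n ∣ (𝔯 : ZMod m).val := by rw [val_r₅ hm hn0]
  -- the four points of `Φ_x` as triples
  have p1 : x = 3 * u₂ := hxu₂.symm
  have p2 : -x = 3 * (-u₂) := by rw [p1]; ring
  have p3 : x + 𝔥 = 3 * (u₂ + 𝔫) := by rw [p1, eh]; ring
  have p4 : -(x + 𝔥) = 3 * (-(u₂ + 𝔫)) := by rw [p1, eh]; ring
  -- the four points of `Φ_{u₂}` modulo `2n`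
  have q3 : (u₂ + 𝔥).val % (2 * n) = (u₂ + 𝔫).val % (2 * n) := by
    rw [show u₂ + 𝔥 = (u₂ + 𝔫) + 𝔯 by rw [eh, er]; ring]
    exact mod_add_of_dvd₅ h2n _ hrval
  have q4 : (-(u₂ + 𝔥)).val % (2 * n) = (-(u₂ + 𝔫)).val % (2 * n) := by
    rw [show -(u₂ + 𝔥) = -(u₂ + 𝔫) + -𝔯 by rw [eh, er]; ring]
    refine mod_add_of_dvd₅ h2n _ ?_
    rw [show -(𝔯 : ZMod m) = 𝔯 + 𝔯 by
      have : (𝔯 : ZMod m) + 𝔯 + 𝔯 = 0 := by rw [er]; linear_combination six_mul_n₅ hm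
      linear_combination -this, ZMod.val_add]
    exact (Nat.dvd_mod_iff h2n).mpr (Nat.dvd_add hrval hrval)
  have key : ∀ t : ZMod m, ((3 : ZMod m) * z = 3 * t) = (t.val % (2 * n) = z.val % (2 * n)) := fun t ↦ by
    rw [three_mul_eq_iff₅ hm]
    exact propext eq_comm
  simp only [phi₅]
  rw [p4, p3, p2, p1]
  simp only [key, q3, q4]

/-- **The distribution vectors of `ℤ/3·2ⁱ⁺¹` are killed by `Φ_x − Φ_{u₁} + Φ_{u₂}`** (`x` odd, `3u₂ = x`, `u₁ ≡ x (mod 2n)`,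
`u₁, u₂` units, `i ≥ 1`). [folklore] -/
private theorem phi₅_third_koD (hm : m = 6 * n) (hn : n = 2 ^ i) (hi : 1 ≤ i) {M : ℕ} (hM : M ∈ m.divisors)
    {x u₁ u₂ : ZMod m} (hx : ¬ 2 ∣ x.val) (hu₁ : ¬ 2 ∣ u₁.val) (hu₁3 : ¬ 3 ∣ u₁.val) (hu₂ : ¬ 2 ∣ u₂.val)
    (hu₂3 : ¬ 3 ∣ u₂.val) (hxu₁ : x.val % (2 * n) = u₁.val % (2 * n)) (hxu₂ : 3 * u₂ = x) (z : ZMod m) :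
    phi₅ n x (koD₅ m M z) - phi₅ n u₁ (koD₅ m M z) + phi₅ n u₂ (koD₅ m M z) = 0 := by
  have hn0 : 0 < n := n_pos₅ hn
  have h2 : 2 ∣ n := two_dvd_n₅ hn hi
  have hMdvd : M ∣ m := Nat.dvd_of_mem_divisors hM
  have hM0 : 0 < M := Nat.pos_of_mem_divisors hM
  obtain ⟨ax, bx, cx⟩ := odd_points₅ hm hn0 h2 hx
  obtain ⟨a1, b1, c1⟩ := odd_points₅ hm hn0 h2 hu₁
  obtain ⟨a2, b2, c2⟩ := odd_points₅ hm hn0 h2 hu₂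
  obtain ⟨a1', b1', c1'⟩ := prime_three_points₅ hm hn0 hu₁3
  obtain ⟨a2', b2', c2'⟩ := prime_three_points₅ hm hn0 hu₂3
  -- split `koD` into its congruence part and its point part
  have split : ∀ y : ZMod m, phi₅ n y (koD₅ m M z) =
      phi₅ n y (fun v ↦ if v.val % M = z.val % M then (1 : ℚ) else 0) -
        phi₅ n y (fun v ↦ if ((m / M : ℕ) : ZMod m) * z = v then (1 : ℚ) else 0) := by
    intro y
    simp only [phi₅, koD₅]
    ring
  rcases dvd_cases₅ hm hn hMdvd with hM3 | hM2 | hMm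
  · -- `M ∣ 3n = m/2`: the point is even, all twelve points are odd
    have hw : 2 ∣ ((((m / M : ℕ)) : ZMod m) * z).val :=
      point_dvd₅ two_pos (two_dvd_m₅ hm) (by rwa [hm, show 6 * n = 2 * (3 * n) by ring, Nat.mul_div_cancel_left _ two_pos])
        hM0 z
    rw [split, split, split, phi₅_congr_eq_zero hm hn0 x z hM3, phi₅_congr_eq_zero hm hn0 u₁ z hM3,
      phi₅_congr_eq_zero hm hn0 u₂ z hM3, phi₅_point_dvd hw hx ax bx cx, phi₅_point_dvd hw hu₁ a1 b1 c1,
      phi₅_point_dvd hw hu₂ a2 b2 c2]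
    ring
  · -- `M = 2n = m/3`: the point is `3z`
    subst hM2
    have h3 : ((m / (2 * n) : ℕ) : ZMod m) = 3 := by rw [hm, show 6 * n = 3 * (2 * n) by ring, Nat.mul_div_cancel _ (by omega)]; norm_cast
    have hw : 3 ∣ ((((m / (2 * n) : ℕ)) : ZMod m) * z).val :=
      point_dvd₅ three_pos (three_dvd_m₅ hm)
        (by rw [hm, show 6 * n = 3 * (2 * n) by ring, Nat.mul_div_cancel_left _ three_pos]) hM0 z
    rw [split, split, split, phi₅_congr_M hMdvd hxu₁ z, phi₅_point_dvd hw hu₁3 a1' b1' c1',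
      phi₅_point_dvd hw hu₂3 a2' b2' c2']
    simp only [h3]
    rw [phi₅_point_third hm hn0 hxu₂ z]
    ring
  · -- `M = m`
    subst hMm
    have hz : koD₅ M M z = fun _ ↦ 0 := funext (koD₅_self z)
    rw [hz]
    simp [phi₅]

/-- **The bridge from Koblitz–Ogus to count identities** (as in part I). A linear functional on functions `ℤ/m → ℚ` that kills
the negation-invariant functions and every distribution vector `D_{M,z}` kills the multiplicity function of a Hodge multiset.
[cite: Deligne1982HodgeCycles, Rem. 7.16 (a)] -/
private theorem functional_count_eq_zero₅ {s : Multiset (ZMod m)} (hs : IsHodgeMultiset s) (L : (ZMod m → ℚ) → ℚ)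
    (hadd : ∀ g g' : ZMod m → ℚ, L (fun z ↦ g z + g' z) = L g + L g')
    (hmul : ∀ (c : ℚ) (g : ZMod m → ℚ), L (fun z ↦ c * g z) = c * L g)
    (hsum : ∀ {ι : Type} (t : Finset ι) (g : ι → ZMod m → ℚ), L (fun z ↦ ∑ j ∈ t, g j z) = ∑ j ∈ t, L (g j))
    (heven : ∀ g : ZMod m → ℚ, (∀ z, g (-z) = g z) → L g = 0)
    (hko : ∀ M ∈ m.divisors, ∀ y : ZMod m, L (koD₅ m M y) = 0) :
    L (fun w ↦ (count w s : ℚ)) = 0 := by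
  classical
  obtain ⟨cr, cd, hrep⟩ := Literature.NumberTheory.Transcendental.KoblitzOgus.hodge_eq_combination
    (N := m) (fun x ↦ (count x s : ℚ)) (fun u hu ↦ hs.sum_count_mul_bern_eq_zero hu)
  have hf : (fun w ↦ (count w s : ℚ)) =
      fun w ↦ (∑ a : ZMod m, cr a * ((if a = w then (1 : ℚ) else 0) + (if -a = w then 1 else 0))) +
        ∑ M ∈ m.divisors, ∑ y : ZMod m, cd M y * koD₅ m M y w := funext hrep
  rw [hf, hadd, hsum, hsum]
  have hA : ∀ a : ZMod m, L (fun w ↦ cr a * ((if a = w then (1 : ℚ) else 0) + (if -a = w then 1 else 0))) = 0 :=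
    fun a ↦ by
      rw [hmul, heven _ fun w ↦ ?_, mul_zero]
      rw [add_comm]
      congr 1
      · simp only [neg_inj]
      · simp only [eq_neg_iff_add_eq_zero, neg_eq_iff_add_eq_zero]
  have hB : ∀ M ∈ m.divisors, L (fun w ↦ ∑ y : ZMod m, cd M y * koD₅ m M y w) = 0 := fun M hM ↦ by
    rw [hsum]
    refine Finset.sum_eq_zero fun y _ ↦ ?_
    rw [hmul, hko M hM y, mul_zero]
  rw [Finset.sum_eq_zero fun a _ ↦ hA a, Finset.sum_eq_zero hB, add_zero]

omit [NeZero m] in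
/-- From a rational identity between counts to the integer one. [folklore] -/
private theorem int_of_rat_eq₅ {a b : ℤ} (h : ((a : ℚ)) = b) : a = b := by exact_mod_cast h

/-- **Koblitz–Ogus at level `3·2ᵃ` (`a ≥ 2`), the third relation.** For a Hodge multiset `s` over `ℤ/6n`, `n = 2ⁱ`, `i ≥ 1`,
`o(w) = #_w s − #_{−w} s`, `d(w) = o(w) − o(w + 3n)`: if `x` is odd (and divisible by `3`), `u₁` is a unit with
`u₁ ≡ x (mod 2n)` and `u₂` is a unit with `3u₂ = x`, then **`d(x) − d(u₁) + d(u₂) = 0`**. PROOF: the tree's PROVED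
`KoblitzOgus.hodge_eq_combination` and `phi₅_third_koD`. This formalisation's lemma (the source proves the span statement; it
replaces part I's hexagon relation, which needs `9 ∣ m`). [cite: Deligne1982HodgeCycles, Rem. 7.16 (a)] [cite: Aoki1983, Prop. 2.2] -/
theorem countSub_third_twoPowThree (hm : m = 6 * n) (hn : n = 2 ^ i) (hi : 1 ≤ i) {s : Multiset (ZMod m)}
    (hs : IsHodgeMultiset s) {x u₁ u₂ : ZMod m} (hx : ¬ 2 ∣ x.val) (hu₁ : ¬ 2 ∣ u₁.val) (hu₁3 : ¬ 3 ∣ u₁.val)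
    (hu₂ : ¬ 2 ∣ u₂.val) (hu₂3 : ¬ 3 ∣ u₂.val) (hxu₁ : x.val % (2 * n) = u₁.val % (2 * n)) (hxu₂ : 3 * u₂ = x) :
    (((count x s : ℤ) - count (-x) s) - ((count (x + 𝔥) s : ℤ) - count (-(x + 𝔥)) s)) -
      (((count u₁ s : ℤ) - count (-u₁) s) - ((count (u₁ + 𝔥) s : ℤ) - count (-(u₁ + 𝔥)) s)) +
      (((count u₂ s : ℤ) - count (-u₂) s) - ((count (u₂ + 𝔥) s : ℤ) - count (-(u₂ + 𝔥)) s)) = 0 := by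
  have key := functional_count_eq_zero₅ hs (fun g ↦ phi₅ n x g - phi₅ n u₁ g + phi₅ n u₂ g)
    (fun g g' ↦ by rw [phi₅_add, phi₅_add, phi₅_add]; ring) (fun c g ↦ by rw [phi₅_mul, phi₅_mul, phi₅_mul]; ring)
    (fun t g ↦ by rw [phi₅_sum, phi₅_sum, phi₅_sum, Finset.sum_add_distrib, Finset.sum_sub_distrib])
    (fun g hg ↦ by rw [phi₅_eq_zero_of_even x hg, phi₅_eq_zero_of_even u₁ hg, phi₅_eq_zero_of_even u₂ hg]; ring)
    (fun M hM z ↦ phi₅_third_koD hm hn hi hM hx hu₁ hu₁3 hu₂ hu₂3 hxu₁ hxu₂ z)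
  simp only [phi₅] at key
  apply int_of_rat_eq₅
  push_cast at key ⊢
  linear_combination key


/-! ### Twelve points in general position: `±(y + j·n)`, `j = 0, …, 5`, for every odd `y` (`i ≥ 3`) -/

omit [NeZero m] in
/-- `j·n` as a residue: `⟨j·n⟩ = j·n` for `j < 6`. [folklore] -/
private theorem val_natCast_mul_n₅ (hm : m = 6 * n) (hn0 : 0 < n) {j : ℕ} (hj : j < 6) :
    (((j : ℕ) : ZMod m) * 𝔫).val = j * n := by
  rw [show ((j : ℕ) : ZMod m) * 𝔫 = ((j * n : ℕ) : ZMod m) by push_cast; ring, ZMod.val_natCast,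
    Nat.mod_eq_of_lt (by rw [hm]; nlinarith)]

omit [NeZero m] in
/-- `j·n = l·n` with `j, l < 6` forces `j = l` (`n > 0`). [folklore] -/
private theorem natCast_mul_n_inj₅ (hm : m = 6 * n) (hn0 : 0 < n) {j l : ℕ} (hj : j < 6) (hl : l < 6)
    (h : ((j : ℕ) : ZMod m) * 𝔫 = ((l : ℕ) : ZMod m) * 𝔫) : j = l := by
  have hv := congrArg ZMod.val h
  rw [val_natCast_mul_n₅ hm hn0 hj, val_natCast_mul_n₅ hm hn0 hl] at hv
  exact Nat.eq_of_mul_eq_mul_right hn0 hv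

omit [NeZero m] in
/-- `t·n = (t mod 6)·n` (`6n = 0`). [folklore] -/
private theorem natCast_mul_n_mod₅ (hm : m = 6 * n) (t : ℕ) :
    ((t : ℕ) : ZMod m) * 𝔫 = (((t % 6 : ℕ)) : ZMod m) * 𝔫 := by
  have h6 := six_mul_n₅ hm
  have et : ((t : ℕ) : ZMod m) = (((t % 6 : ℕ)) : ZMod m) + 6 * (((t / 6 : ℕ)) : ZMod m) := by
    norm_cast; rw [Nat.mod_add_div]
  rw [et]
  linear_combination (((t / 6 : ℕ)) : ZMod m) * h6

omit [NeZero m] in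
/-- `2 ∣ ⟨j·n⟩` (`2 ∣ n`). [folklore] -/
private theorem two_dvd_val_mul_n₅ (hm : m = 6 * n) (h2 : 2 ∣ n) (j : ℕ) : 2 ∣ (((j : ℕ) : ZMod m) * 𝔫).val := by
  rw [show ((j : ℕ) : ZMod m) * 𝔫 = ((j * n : ℕ) : ZMod m) by push_cast; ring, ZMod.val_natCast]
  exact (Nat.dvd_mod_iff (two_dvd_m₅ hm)).mpr (Dvd.dvd.mul_left h2 j)

/-- `y + j·n` is odd when `y` is (`2 ∣ n`). [folklore] -/
private theorem odd_add_mul_n₅ (hm : m = 6 * n) (h2 : 2 ∣ n) {y : ZMod m} (hy : ¬ 2 ∣ y.val) (j : ℕ) :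
    ¬ 2 ∣ (y + ((j : ℕ) : ZMod m) * 𝔫).val := by
  rwa [dvd_val_add_iff₅ (two_dvd_m₅ hm) y (two_dvd_val_mul_n₅ hm h2 j)]

/-- `y + 2n ≡ y` and `y + 4n ≡ y (mod 2n)`. [folklore] -/
private theorem mod_two_n_add₅ (hm : m = 6 * n) (hn0 : 0 < n) (y : ZMod m) :
    (y + 2 * 𝔫).val % (2 * n) = y.val % (2 * n) ∧ (y + 4 * 𝔫).val % (2 * n) = y.val % (2 * n) := by
  have h2n : 2 * n ∣ m := ⟨3, by rw [hm]; ring⟩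
  have v2 : ((2 : ZMod m) * 𝔫).val = 2 * n := by
    simpa using val_natCast_mul_n₅ hm hn0 (j := 2) (by omega)
  have v4 : ((4 : ZMod m) * 𝔫).val = 4 * n := by
    simpa using val_natCast_mul_n₅ hm hn0 (j := 4) (by omega)
  exact ⟨mod_add_of_dvd₅ h2n y (by rw [v2]), mod_add_of_dvd₅ h2n y (by rw [v4]; exact ⟨2, by ring⟩)⟩

/-- **`c·y + j·n ≠ 0`** for `y` odd and `c ∈ {2, 4}` (`8 ∣ n`): reduce modulo `8`. [folklore] -/
private theorem natMul_add_ne_zero₅ (hm : m = 6 * n) (hn : n = 2 ^ i) (hi : 3 ≤ i) {y : ZMod m} (hy : ¬ 2 ∣ y.val)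
    {c : ℕ} (hc : c = 2 ∨ c = 4) (j : ℕ) : (c : ZMod m) * y + ((j : ℕ) : ZMod m) * 𝔫 ≠ 0 := by
  intro h
  have h8m : 8 ∣ m := eight_dvd_m₅ hm hn (by omega)
  set σ := ZMod.castHom h8m (ZMod 8) with hσ
  have hn8 : σ (((j : ℕ) : ZMod m) * 𝔫) = 0 := by
    rw [_root_.map_mul, map_natCast, map_natCast, (ZMod.natCast_eq_zero_iff n 8).mpr (eight_dvd_n₅ hn hi), mul_zero]
  have hyσ : (σ y).val % 2 = 1 := by
    rw [hσ, ZMod.castHom_apply, ZMod.cast_eq_val, ZMod.val_natCast, Nat.mod_mod_of_dvd _ (by norm_num : 2 ∣ 8)]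
    omega
  have e := congrArg σ h
  rw [_root_.map_add, _root_.map_mul, hn8, add_zero, map_natCast, _root_.map_zero] at e
  have key : ∀ a : ZMod 8, a.val % 2 = 1 → ((2 : ℕ) : ZMod 8) * a ≠ 0 ∧ ((4 : ℕ) : ZMod 8) * a ≠ 0 := by decide
  rcases hc with rfl | rfl
  · exact (key _ hyσ).1 e
  · exact (key _ hyσ).2 e

/-- **`2y + j·n ≠ 0`** for `y` odd (`8 ∣ n`). [folklore] -/
private theorem two_mul_add_ne_zero₅ (hm : m = 6 * n) (hn : n = 2 ^ i) (hi : 3 ≤ i) {y : ZMod m} (hy : ¬ 2 ∣ y.val)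
    (j : ℕ) : 2 * y + ((j : ℕ) : ZMod m) * 𝔫 ≠ 0 := by
  simpa using natMul_add_ne_zero₅ hm hn hi hy (c := 2) (Or.inl rfl) j

variable (n) in
/-- The twelve points `±(y + j·n)`, `j = 0, …, 5`, indexed by `Fin 2 × Fin 6`. [folklore] -/
private def pt₅ (y : ZMod m) (e : Fin 2 × Fin 6) : ZMod m :=
  if e.1 = 0 then y + ((e.2 : ℕ) : ZMod m) * 𝔫 else -(y + ((e.2 : ℕ) : ZMod m) * 𝔫)

/-- **The twelve points `±(y + j·n)` are pairwise distinct** for every odd `y` (`8 ∣ n`): equal signs differ by `(j − l)·n ≠ 0`,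
opposite signs would give `2y + (j + l)·n = 0`, impossible modulo `8`. [folklore] -/
private theorem pt₅_injective (hm : m = 6 * n) (hn : n = 2 ^ i) (hi : 3 ≤ i) {y : ZMod m} (hy : ¬ 2 ∣ y.val) :
    Function.Injective (pt₅ n y) := by
  have hn0 := n_pos₅ hn
  rintro ⟨e, j⟩ ⟨e', l⟩ h
  have hj := j.isLt
  have hl := l.isLt
  have same : y + ((j : ℕ) : ZMod m) * 𝔫 = y + ((l : ℕ) : ZMod m) * 𝔫 → j = l := fun e ↦
    Fin.ext (natCast_mul_n_inj₅ hm hn0 hj hl (add_left_cancel e))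
  have opp : y + ((j : ℕ) : ZMod m) * 𝔫 ≠ -(y + ((l : ℕ) : ZMod m) * 𝔫) := by
    intro e2
    apply two_mul_add_ne_zero₅ hm hn hi hy (j + l)
    push_cast
    linear_combination e2
  have opp' : -(y + ((j : ℕ) : ZMod m) * 𝔫) ≠ y + ((l : ℕ) : ZMod m) * 𝔫 := by
    intro e2
    apply two_mul_add_ne_zero₅ hm hn hi hy (l + j)
    push_cast
    linear_combination -e2
  fin_cases e <;> fin_cases e'
  · simp only [pt₅, Fin.zero_eta, Fin.isValue, ↓reduceIte] at h
    rw [same h]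
  · simp only [pt₅, Fin.zero_eta, Fin.isValue, ↓reduceIte, Fin.mk_one, one_ne_zero] at h
    exact absurd h opp
  · simp only [pt₅, Fin.mk_one, Fin.isValue, one_ne_zero, ↓reduceIte, Fin.zero_eta] at h
    exact absurd h opp'
  · simp only [pt₅, Fin.mk_one, Fin.isValue, one_ne_zero, ↓reduceIte, neg_inj] at h
    rw [same h]

omit [NeZero m] in
/-- The counts of a multiset over any finite set of points add up to at most its cardinality. [folklore] -/
private theorem sum_count_le_card₅ (F : Finset (ZMod m)) (s : Multiset (ZMod m)) : ∑ a ∈ F, count a s ≤ card s := by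
  classical
  calc ∑ a ∈ F, count a s ≤ ∑ a ∈ F ∪ s.toFinset, count a s :=
        Finset.sum_le_sum_of_subset Finset.subset_union_left
    _ = card s := Multiset.sum_count_eq_card fun a ha ↦ Finset.mem_union_right _ (Multiset.mem_toFinset.mpr ha)

/-- **Mass bound.** The multiplicities of a multiset `s` at the twelve points `±(y + j·n)` add up to at most `#s`. [folklore] -/
private theorem mass_le₅ (hm : m = 6 * n) (hn : n = 2 ^ i) (hi : 3 ≤ i) {y : ZMod m} (hy : ¬ 2 ∣ y.val)
    (s : Multiset (ZMod m)) :
    count y s + count (-y) s + (count (y + 𝔫) s + count (-(y + 𝔫)) s) +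
      (count (y + 2 * 𝔫) s + count (-(y + 2 * 𝔫)) s) + (count (y + 3 * 𝔫) s + count (-(y + 3 * 𝔫)) s) +
      (count (y + 4 * 𝔫) s + count (-(y + 4 * 𝔫)) s) + (count (y + 5 * 𝔫) s + count (-(y + 5 * 𝔫)) s) ≤ card s := by
  classical
  have key := sum_count_le_card₅ (Finset.univ.map ⟨pt₅ n y, pt₅_injective hm hn hi hy⟩) s
  rw [Finset.sum_map, Fintype.sum_prod_type, Fin.sum_univ_two, Fin.sum_univ_six, Fin.sum_univ_six] at key
  simp only [Function.Embedding.coeFn_mk, pt₅, Fin.isValue, ↓reduceIte, one_ne_zero, Fin.val_zero, Nat.cast_zero,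
    zero_mul, add_zero, Fin.val_one, Nat.cast_one, one_mul, Fin.val_two, Nat.cast_ofNat] at key
  have e3 : ((3 : Fin 6) : ℕ) = 3 := rfl
  have e4 : ((4 : Fin 6) : ℕ) = 4 := rfl
  have e5 : ((5 : Fin 6) : ℕ) = 5 := rfl
  simp only [e3, e4, e5, Nat.cast_ofNat] at key
  omega

/-! ### Pair-free multisets (as in part I) -/

omit [NeZero m] in
/-- In a pair-free multiset, a member `w ≠ −w` excludes `−w`. [cite: Shioda1982PicardFermat, §2 p. 726] -/
private theorem count_neg_eq_zero_of_not_hasPair₅ {s : Multiset (ZMod m)} (hpf : ¬ HasPair s) {w : ZMod m} (hw : w ≠ -w)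
    (hws : 0 < count w s) : count (-w) s = 0 := by
  by_contra h
  apply hpf
  refine ⟨w, Multiset.count_pos.mp hws, ?_⟩
  rw [← Multiset.count_pos, Multiset.count_erase_of_ne hw.symm]
  exact Nat.pos_of_ne_zero h

omit [NeZero m] in
/-- In a pair-free multiset, for `w ≠ −w` one of `#_w`, `#_{−w}` vanishes. [folklore] -/
private theorem count_or_count_neg_eq_zero₅ {s : Multiset (ZMod m)} (hpf : ¬ HasPair s) {w : ZMod m} (hw : w ≠ -w) :
    count w s = 0 ∨ count (-w) s = 0 := by
  by_cases h : count w s = 0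
  · exact Or.inl h
  · exact Or.inr (count_neg_eq_zero_of_not_hasPair₅ hpf hw (Nat.pos_of_ne_zero h))

/-- `w ≠ −w` for `w = y + j·n` with `y` odd (`2w = 2y + 2j·n ≠ 0`). [folklore] -/
private theorem ne_neg_of_odd₅ (hm : m = 6 * n) (hn : n = 2 ^ i) (hi : 3 ≤ i) {y : ZMod m} (hy : ¬ 2 ∣ y.val) (j : ℕ) :
    y + ((j : ℕ) : ZMod m) * 𝔫 ≠ -(y + ((j : ℕ) : ZMod m) * 𝔫) := by
  intro e
  apply two_mul_add_ne_zero₅ hm hn hi hy (j + j)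
  push_cast
  linear_combination e

omit [NeZero m] in
/-- `y + j·n ≠ y + l·n` for `j ≠ l` below `6`. [folklore] -/
private theorem add_mul_n_ne₅ (hm : m = 6 * n) (hn0 : 0 < n) (y : ZMod m) {j l : ℕ} (hj : j < 6) (hl : l < 6) (hjl : j ≠ l) :
    y + ((j : ℕ) : ZMod m) * 𝔫 ≠ y + ((l : ℕ) : ZMod m) * 𝔫 :=
  fun e ↦ hjl (natCast_mul_n_inj₅ hm hn0 hj hl (add_left_cancel e))

/-- `y + j·n ≠ −(y + l·n)` for `y` odd. [folklore] -/
private theorem add_mul_n_ne_neg₅ (hm : m = 6 * n) (hn : n = 2 ^ i) (hi : 3 ≤ i) {y : ZMod m} (hy : ¬ 2 ∣ y.val) (j l : ℕ) :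
    y + ((j : ℕ) : ZMod m) * 𝔫 ≠ -(y + ((l : ℕ) : ZMod m) * 𝔫) := by
  intro e
  apply two_mul_add_ne_zero₅ hm hn hi hy (j + l)
  push_cast
  linear_combination e

omit [NeZero m] in
/-- Three distinct members of a `4`-multiset leave one more member. [folklore] -/
private theorem exists_eq_of_three_mem₅ {s : Multiset (ZMod m)} (hcard : card s = 4) {a b c : ZMod m}
    (ha : a ∈ s) (hb : b ∈ s) (hc : c ∈ s) (hab : a ≠ b) (hac : a ≠ c) (hbc : b ≠ c) :
    ∃ t, s = a ::ₘ b ::ₘ c ::ₘ {t} := by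
  have h1 : s = a ::ₘ s.erase a := (Multiset.cons_erase ha).symm
  have hb' : b ∈ s.erase a := (Multiset.mem_erase_of_ne hab.symm).mpr hb
  have h2 : s.erase a = b ::ₘ (s.erase a).erase b := (Multiset.cons_erase hb').symm
  have hc' : c ∈ (s.erase a).erase b :=
    (Multiset.mem_erase_of_ne hbc.symm).mpr ((Multiset.mem_erase_of_ne hac.symm).mpr hc)
  have h3 : (s.erase a).erase b = c ::ₘ ((s.erase a).erase b).erase c := (Multiset.cons_erase hc').symm
  have hcard' : card (((s.erase a).erase b).erase c) = 1 := by
    rw [Multiset.card_erase_of_mem hc', Multiset.card_erase_of_mem hb', Multiset.card_erase_of_mem ha, hcard]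
    rfl
  obtain ⟨t, ht⟩ := Multiset.card_eq_one.mp hcard'
  exact ⟨t, by rw [h1, h2, h3, ht]⟩

omit [NeZero m] in
/-- Four distinct members of a `4`-multiset are all of it. [folklore] -/
private theorem eq_of_four_mem₅ {s : Multiset (ZMod m)} (hcard : card s = 4) {a b c d : ZMod m}
    (ha : a ∈ s) (hb : b ∈ s) (hc : c ∈ s) (hd : d ∈ s) (hab : a ≠ b) (hac : a ≠ c) (had : a ≠ d) (hbc : b ≠ c)
    (hbd : b ≠ d) (hcd : c ≠ d) : s = a ::ₘ b ::ₘ c ::ₘ {d} := by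
  obtain ⟨t, ht⟩ := exists_eq_of_three_mem₅ hcard ha hb hc hab hac hbc
  have hd' := hd
  rw [ht] at hd'
  simp only [Multiset.mem_cons, Multiset.mem_singleton] at hd'
  rcases hd' with h | h | h | h
  · exact absurd h.symm had
  · exact absurd h.symm hbd
  · exact absurd h.symm hcd
  · rw [ht, h]

omit [NeZero m] in
/-- The sum of `{a, b, c, t}`. [folklore] -/
private theorem sum_four₅ (a b c t : ZMod m) : (a ::ₘ b ::ₘ c ::ₘ ({t} : Multiset (ZMod m))).sum = a + b + c + t := by
  simp only [Multiset.sum_cons, Multiset.sum_singleton]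
  ring

omit [NeZero m] in
/-- In `{a, b, c, c}` the member `c` occurs at least twice. [folklore] -/
private theorem two_le_count_c₅ (a b c : ZMod m) : 2 ≤ count c (a ::ₘ b ::ₘ c ::ₘ ({c} : Multiset (ZMod m))) := by
  classical
  have h : c ::ₘ ({c} : Multiset (ZMod m)) ≤ a ::ₘ b ::ₘ c ::ₘ ({c} : Multiset (ZMod m)) :=
    (Multiset.le_cons_self _ _).trans (Multiset.le_cons_self _ _)
  calc 2 = count c (c ::ₘ ({c} : Multiset (ZMod m))) := by simp
    _ ≤ _ := Multiset.count_le_of_le _ h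

omit [NeZero m] in
/-- In `{a, b, c, b}` the member `b` occurs at least twice. [folklore] -/
private theorem two_le_count_b₅ (a b c : ZMod m) : 2 ≤ count b (a ::ₘ b ::ₘ c ::ₘ ({b} : Multiset (ZMod m))) := by
  classical
  have h : b ::ₘ ({b} : Multiset (ZMod m)) ≤ a ::ₘ b ::ₘ c ::ₘ ({b} : Multiset (ZMod m)) :=
    (Multiset.cons_le_cons b (Multiset.le_cons_self _ c)).trans (Multiset.le_cons_self _ a)
  calc 2 = count b (b ::ₘ ({b} : Multiset (ZMod m))) := by simp
    _ ≤ _ := Multiset.count_le_of_le _ h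

omit [NeZero m] in
/-- In `{a, b, c, a}` the member `a` occurs at least twice. [folklore] -/
private theorem two_le_count_a₅ (a b c : ZMod m) : 2 ≤ count a (a ::ₘ b ::ₘ c ::ₘ ({a} : Multiset (ZMod m))) := by
  classical
  have h : a ::ₘ ({a} : Multiset (ZMod m)) ≤ a ::ₘ b ::ₘ c ::ₘ ({a} : Multiset (ZMod m)) :=
    Multiset.cons_le_cons a ((Multiset.le_cons_self _ c).trans (Multiset.le_cons_self _ b))
  calc 2 = count a (a ::ₘ ({a} : Multiset (ZMod m))) := by simp
    _ ≤ _ := Multiset.count_le_of_le _ h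

/-! ### From the two hexagon identities to twin or `γ` (part I's count arithmetic, at every odd `y`) -/

/-- The arithmetic of the twelve multiplicities (`c_j = #_{y + jn}`, `c'_j = #_{−(y + jn)}`): the two hexagon identities, the
mass bound, `c₀ ≥ 1`, `c'₀ = 0` and pair-freeness leave the twin (`c₃ = c₀`) or `c₀ = 1` with one member in each of
`{y + 2n, −(y + 5n)}`, `{y + 4n, −(y + n)}`. [folklore] -/
private theorem shape_arith₅ {c0 c0' c1 c1' c2 c2' c3 c3' c4 c4' c5 c5' : ℕ}
    (E1 : ((c0 : ℤ) - c0') - ((c3 : ℤ) - c3') = ((c2 : ℤ) - c2') - ((c5 : ℤ) - c5'))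
    (E2 : ((c2 : ℤ) - c2') - ((c5 : ℤ) - c5') = ((c4 : ℤ) - c4') - ((c1 : ℤ) - c1'))
    (M : c0 + c0' + (c1 + c1') + (c2 + c2') + (c3 + c3') + (c4 + c4') + (c5 + c5') ≤ 4)
    (a1 : 1 ≤ c0) (n0 : c0' = 0) (n3 : c3 = 0 ∨ c3' = 0) (n4 : c4 = 0 ∨ c4' = 0) (n5 : c5 = 0 ∨ c5' = 0) :
    c3 = c0 ∨ (c0 = 1 ∧ c2 = 1 ∧ c4 = 1) ∨ (c0 = 1 ∧ c2 = 1 ∧ c1' = 1) ∨ (c0 = 1 ∧ c5' = 1 ∧ c4 = 1) ∨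
      (c0 = 1 ∧ c5' = 1 ∧ c1' = 1) := by
  omega

/-- **Twin or `γ` from the two hexagon identities** (part I's argument, valid for every odd member `y` of a pair-free Hodge
`4`-multiset once `o(y) − o(y+3n) = o(y+2n) − o(y+5n) = o(y+4n) − o(y+n)` is known; `8 ∣ n`). [cite: Shioda1982PicardFermat, Lemma 1 (b), Prop. 4 (Q′)] -/
private theorem twin_or_gamma_of_hexagon₅ (hm : m = 6 * n) (hn : n = 2 ^ i) (hi : 3 ≤ i) {s : Multiset (ZMod m)}
    (hs : IsHodgeMultiset s) (hcard : card s = 4) (hpf : ¬ HasPair s) {y : ZMod m} (hy : y ∈ s) (hy2 : ¬ 2 ∣ y.val)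
    (E1 : ((count y s : ℤ) - count (-y) s) - ((count (y + 3 * 𝔫) s : ℤ) - count (-(y + 3 * 𝔫)) s) =
      ((count (y + 2 * 𝔫) s : ℤ) - count (-(y + 2 * 𝔫)) s) - ((count (y + 5 * 𝔫) s : ℤ) - count (-(y + 5 * 𝔫)) s))
    (E2 : ((count (y + 2 * 𝔫) s : ℤ) - count (-(y + 2 * 𝔫)) s) - ((count (y + 5 * 𝔫) s : ℤ) - count (-(y + 5 * 𝔫)) s) =
      ((count (y + 4 * 𝔫) s : ℤ) - count (-(y + 4 * 𝔫)) s) - ((count (y + 𝔫) s : ℤ) - count (-(y + 𝔫)) s)) :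
    count (y + 3 * 𝔫) s = count y s ∨ s = y ::ₘ (y + 2 * 𝔫) ::ₘ (y + 4 * 𝔫) ::ₘ {-(3 * y)} := by
  classical
  have hn0 : 0 < n := n_pos₅ hn
  have h6 := six_mul_n₅ hm
  have M := mass_le₅ hm hn hi hy2 s
  rw [hcard] at M
  have a1 : 1 ≤ count y s := Multiset.one_le_count_iff_mem.mpr hy
  have inj := pt₅_injective hm hn hi hy2
  have nn : ∀ j : ℕ, count (y + ((j : ℕ) : ZMod m) * 𝔫) s = 0 ∨ count (-(y + ((j : ℕ) : ZMod m) * 𝔫)) s = 0 :=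
    fun j ↦ count_or_count_neg_eq_zero₅ hpf (ne_neg_of_odd₅ hm hn hi hy2 j)
  have n0 : count (-y) s = 0 :=
    count_neg_eq_zero_of_not_hasPair₅ hpf (w := y) (by simpa using ne_neg_of_odd₅ hm hn hi hy2 0) a1
  have n3 := nn 3
  have n4 := nn 4
  have n5 := nn 5
  simp only [Nat.cast_ofNat] at n3 n4 n5
  have shape : count (y + 3 * 𝔫) s = count y s ∨
      (count y s = 1 ∧ count (y + 2 * 𝔫) s = 1 ∧ count (y + 4 * 𝔫) s = 1) ∨
      (count y s = 1 ∧ count (y + 2 * 𝔫) s = 1 ∧ count (-(y + 𝔫)) s = 1) ∨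
      (count y s = 1 ∧ count (-(y + 5 * 𝔫)) s = 1 ∧ count (y + 4 * 𝔫) s = 1) ∨
      (count y s = 1 ∧ count (-(y + 5 * 𝔫)) s = 1 ∧ count (-(y + 𝔫)) s = 1) :=
    shape_arith₅ E1 E2 M a1 n0 n3 n4 n5
  have p0 : y = pt₅ n y (0, 0) := by simp [pt₅]
  have p2 : y + 2 * 𝔫 = pt₅ n y (0, 2) := by simp [pt₅]
  have p4 : y + 4 * 𝔫 = pt₅ n y (0, 4) := by simp [pt₅]
  have q1 : -(y + 𝔫) = pt₅ n y (1, 1) := by simp [pt₅]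
  have q5 : -(y + 5 * 𝔫) = pt₅ n y (1, 5) := by simp [pt₅]
  have D : ∀ e e' : Fin 2 × Fin 6, e ≠ e' → ∀ {A B : ZMod m}, A = pt₅ n y e → B = pt₅ n y e' → A ≠ B :=
    fun e e' h A B hA hB hAB ↦ h (inj (by rw [← hA, ← hB, hAB]))
  have hsum : s.sum = 0 := hs.1.2
  rcases shape with h | ⟨c0, c2, c4⟩ | ⟨c0, c2, c1⟩ | ⟨c0, c5, c4⟩ | ⟨c0, c5, c1⟩
  · exact Or.inl h
  · right
    obtain ⟨t, ht⟩ := exists_eq_of_three_mem₅ hcard hy (Multiset.count_pos.mp (by rw [c2]; exact Nat.one_pos))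
      (Multiset.count_pos.mp (by rw [c4]; exact Nat.one_pos)) (D _ _ (by decide) p0 p2)
      (D _ _ (by decide) p0 p4) (D _ _ (by decide) p2 p4)
    have htsum := hsum
    rw [ht, sum_four₅] at htsum
    have htt : t = -(3 * y) := by linear_combination htsum - h6
    rw [ht, htt]
  · exfalso
    obtain ⟨t, ht⟩ := exists_eq_of_three_mem₅ hcard hy (Multiset.count_pos.mp (by rw [c2]; exact Nat.one_pos))
      (Multiset.count_pos.mp (by rw [c1]; exact Nat.one_pos)) (D _ _ (by decide) p0 p2)
      (D _ _ (by decide) p0 q1) (D _ _ (by decide) p2 q1)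
    have htsum := hsum
    rw [ht, sum_four₅] at htsum
    have htt : t = -(y + 𝔫) := by linear_combination htsum
    rw [htt] at ht
    rw [ht] at c1
    have two := two_le_count_c₅ y (y + 2 * 𝔫) (-(y + 𝔫))
    omega
  · exfalso
    obtain ⟨t, ht⟩ := exists_eq_of_three_mem₅ hcard hy (Multiset.count_pos.mp (by rw [c5]; exact Nat.one_pos))
      (Multiset.count_pos.mp (by rw [c4]; exact Nat.one_pos)) (D _ _ (by decide) p0 q5)
      (D _ _ (by decide) p0 p4) (D _ _ (by decide) q5 p4)
    have htsum := hsum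
    rw [ht, sum_four₅] at htsum
    have htt : t = -(y + 5 * 𝔫) := by linear_combination htsum + h6
    rw [htt] at ht
    rw [ht] at c5
    have two := two_le_count_b₅ y (-(y + 5 * 𝔫)) (y + 4 * 𝔫)
    omega
  · exfalso
    obtain ⟨t, ht⟩ := exists_eq_of_three_mem₅ hcard hy (Multiset.count_pos.mp (by rw [c5]; exact Nat.one_pos))
      (Multiset.count_pos.mp (by rw [c1]; exact Nat.one_pos)) (D _ _ (by decide) p0 q5)
      (D _ _ (by decide) p0 q1) (D _ _ (by decide) q5 q1)
    have htsum := hsum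
    rw [ht, sum_four₅] at htsum
    have htt : t = y := by linear_combination htsum + h6
    rw [htt] at ht
    rw [ht] at c0
    have two := two_le_count_a₅ y (-(y + 5 * 𝔫)) (-(y + 𝔫))
    omega


/-! ### The classes of units modulo `2n` at `b = 1`: `{y, y + 2n, y + 4n}` has exactly one multiple of `3` -/

/-- For `y` prime to `3` (`3 ∤ n`): exactly one of `y + 2n`, `y + 4n` is divisible by `3`. [folklore] -/
private theorem third_class₅ (hm : m = 6 * n) (hn : n = 2 ^ i) {y : ZMod m} (hy3 : ¬ 3 ∣ y.val) :
    (3 ∣ (y + 2 * 𝔫).val ∧ ¬ 3 ∣ (y + 4 * 𝔫).val) ∨ (¬ 3 ∣ (y + 2 * 𝔫).val ∧ 3 ∣ (y + 4 * 𝔫).val) := by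
  have h3m := three_dvd_m₅ hm
  set ρ := ZMod.castHom h3m (ZMod 3) with hρ
  have hρn : ρ 𝔫 ≠ 0 := by
    rw [map_natCast, Ne, ZMod.natCast_eq_zero_iff]
    exact not_three_dvd_n₅ hn
  have hρy : ρ y ≠ 0 := fun e ↦ hy3 ((dvd_val_iff_cast₅ h3m y).mpr e)
  have key : ∀ a b : ZMod 3, a ≠ 0 → b ≠ 0 →
      (a + 2 * b = 0 ∧ a + 4 * b ≠ 0) ∨ (a + 2 * b ≠ 0 ∧ a + 4 * b = 0) := by decide
  simp only [dvd_val_iff_cast₅ h3m, _root_.map_add, _root_.map_mul, map_ofNat]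
  exact key _ _ hρy hρn

/-- **A unit third.** An odd `x` divisible by `3` has a third `u` (`3u = x`) which is odd and prime to `3` (the three thirds of
`x` are `u₀, u₀ + 2n, u₀ + 4n`). [folklore] -/
private theorem exists_unit_third₅ (hm : m = 6 * n) (hn : n = 2 ^ i) (hi : 1 ≤ i) {x : ZMod m} (hx : ¬ 2 ∣ x.val)
    (hx3 : 3 ∣ x.val) : ∃ u : ZMod m, 3 * u = x ∧ ¬ 2 ∣ u.val ∧ ¬ 3 ∣ u.val := by
  have hn0 := n_pos₅ hn
  have h2 := two_dvd_n₅ hn hi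
  have h3m := three_dvd_m₅ hm
  obtain ⟨q, hq⟩ := hx3
  set u₀ : ZMod m := ((q : ℕ) : ZMod m) with hu₀
  have hqlt : q < m := by have := ZMod.val_lt x; omega
  have hu₀val : u₀.val = q := by rw [hu₀, ZMod.val_natCast, Nat.mod_eq_of_lt hqlt]
  have h3u₀ : 3 * u₀ = x := by
    rw [hu₀, show (3 : ZMod m) * ((q : ℕ) : ZMod m) = (((3 * q : ℕ)) : ZMod m) by push_cast; ring, ← hq,
      ZMod.natCast_zmod_val]
  have hu₀2 : ¬ 2 ∣ u₀.val := by
    rw [hu₀val]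
    intro h
    exact hx (by rw [hq]; exact Dvd.dvd.mul_left h 3)
  by_cases hu₀3 : 3 ∣ u₀.val
  · refine ⟨u₀ + 𝔯, ?_, ?_, ?_⟩
    · rw [mul_add, h3u₀, h_eq_three_mul₅.2]
      linear_combination six_mul_n₅ hm
    · rwa [dvd_val_add_iff₅ (two_dvd_m₅ hm) u₀ (by rw [val_r₅ hm hn0]; exact ⟨n, rfl⟩)]
    · set ρ := ZMod.castHom h3m (ZMod 3) with hρ
      have hρr : ρ 𝔯 ≠ 0 := by
        rw [map_natCast, Ne, ZMod.natCast_eq_zero_iff]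
        intro h
        exact not_three_dvd_n₅ hn ((Nat.Prime.dvd_mul Nat.prime_three).mp h |>.resolve_left (by norm_num))
      rw [dvd_val_iff_cast₅ h3m, _root_.map_add, (dvd_val_iff_cast₅ h3m u₀).mp hu₀3, zero_add]
      exact hρr
  · exact ⟨u₀, h3u₀, hu₀2, hu₀3⟩

/-! ### Hexagons `±w + nℤ` and their groups `{±w, ±(w + 3n)}` -/

omit [NeZero m] in
/-- The reduction modulo `n` kills `n`. [folklore] -/
private theorem castHom_n₅ (hnm : n ∣ m) : ZMod.castHom hnm (ZMod n) 𝔫 = 0 := by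
  rw [map_natCast, ZMod.natCast_self]

omit [NeZero m] in
/-- **Disjoint hexagons.** If `b ≢ ±a (mod n)` then no point `±(a + j·n)` equals a point `±(b + l·n)`. [folklore] -/
private theorem ne_of_hexagons₅ (hnm : n ∣ m) {a b g g' : ZMod m}
    (h₁ : ZMod.castHom hnm (ZMod n) b ≠ ZMod.castHom hnm (ZMod n) a)
    (h₂ : ZMod.castHom hnm (ZMod n) b ≠ -ZMod.castHom hnm (ZMod n) a)
    (hg : ∃ j : ℕ, g = a + ((j : ℕ) : ZMod m) * 𝔫 ∨ g = -(a + ((j : ℕ) : ZMod m) * 𝔫))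
    (hg' : ∃ l : ℕ, g' = b + ((l : ℕ) : ZMod m) * 𝔫 ∨ g' = -(b + ((l : ℕ) : ZMod m) * 𝔫)) : g ≠ g' := by
  set π := ZMod.castHom hnm (ZMod n) with hπ
  have hπn : π 𝔫 = 0 := castHom_n₅ hnm
  rintro rfl
  obtain ⟨j, hj⟩ := hg
  obtain ⟨l, hl⟩ := hg'
  have ea : ∀ t : ℕ, π (a + ((t : ℕ) : ZMod m) * 𝔫) = π a := fun t ↦ by
    rw [_root_.map_add, _root_.map_mul, hπn, mul_zero, add_zero]
  have eb : ∀ t : ℕ, π (b + ((t : ℕ) : ZMod m) * 𝔫) = π b := fun t ↦ by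
    rw [_root_.map_add, _root_.map_mul, hπn, mul_zero, add_zero]
  rcases hj with hj | hj <;> rcases hl with hl | hl
  · have e := congrArg π (hj.symm.trans hl)
    rw [ea, eb] at e
    exact h₁ e.symm
  · have e := congrArg π (hj.symm.trans hl)
    rw [ea, _root_.map_neg, eb] at e
    exact h₂ (by linear_combination e)
  · have e := congrArg π (hj.symm.trans hl)
    rw [_root_.map_neg, ea, eb] at e
    exact h₂ (by linear_combination -e)
  · have e := congrArg π (hj.symm.trans hl)
    rw [_root_.map_neg, _root_.map_neg, ea, eb, neg_inj] at e
    exact h₁ e.symm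

omit [NeZero m] in
/-- The group `{±w, ±(w + 3n)}` of `w = a + j·n` lies on the hexagon of `a`. [folklore] -/
private theorem hexagon_of_group₅ {a w g : ZMod m} {j : ℕ} (hw : w = a + ((j : ℕ) : ZMod m) * 𝔫)
    (hg : g = w ∨ g = -w ∨ g = w + 𝔥 ∨ g = -(w + 𝔥)) :
    ∃ l : ℕ, g = a + ((l : ℕ) : ZMod m) * 𝔫 ∨ g = -(a + ((l : ℕ) : ZMod m) * 𝔫) := by
  have eh : (𝔥 : ZMod m) = 3 * 𝔫 := h_eq_three_mul₅.1
  have e3 : w + 𝔥 = a + (((j + 3 : ℕ)) : ZMod m) * 𝔫 := by rw [hw, eh]; push_cast; ring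
  rcases hg with rfl | rfl | rfl | rfl
  · exact ⟨j, Or.inl hw⟩
  · exact ⟨j, Or.inr (by rw [hw])⟩
  · exact ⟨j + 3, Or.inl e3⟩
  · exact ⟨j + 3, Or.inr (by rw [e3])⟩

omit [NeZero m] in
/-- A member of the group of `w = a + j·n` (`j < 6`) is a point `pt₅ a (e, l)` with `l ≡ j (mod 3)`. [folklore] -/
private theorem repr_group₅ (hm : m = 6 * n) {a w g : ZMod m} {j : ℕ} (hj : j < 6) (hw : w = a + ((j : ℕ) : ZMod m) * 𝔫)
    (hg : g = w ∨ g = -w ∨ g = w + 𝔥 ∨ g = -(w + 𝔥)) :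
    ∃ (e : Fin 2) (l : Fin 6), (l : ℕ) % 3 = j % 3 ∧ g = pt₅ n a (e, l) := by
  have eh : (𝔥 : ZMod m) = 3 * 𝔫 := h_eq_three_mul₅.1
  have e3 : w + 𝔥 = a + ((((j + 3) % 6 : ℕ)) : ZMod m) * 𝔫 := by
    rw [hw, eh, ← natCast_mul_n_mod₅ hm]; push_cast; ring
  have hmod : (j + 3) % 6 % 3 = j % 3 := by omega
  rcases hg with rfl | rfl | rfl | rfl
  · exact ⟨0, ⟨j, hj⟩, rfl, by simp [pt₅, hw]⟩
  · exact ⟨1, ⟨j, hj⟩, rfl, by simp [pt₅, hw]⟩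
  · exact ⟨0, ⟨(j + 3) % 6, Nat.mod_lt _ (by norm_num)⟩, hmod, by simp only [pt₅, Fin.isValue, ↓reduceIte]; exact e3⟩
  · exact ⟨1, ⟨(j + 3) % 6, Nat.mod_lt _ (by norm_num)⟩, hmod, by
      simp only [pt₅, Fin.isValue, one_ne_zero, ↓reduceIte]; rw [e3]⟩

/-- **Distinct groups on one hexagon.** For an odd `a` (`8 ∣ n`) the groups of `a + j·n` and `a + l·n` with `j ≢ l (mod 3)`
are disjoint. [folklore] -/
private theorem ne_of_groups₅ (hm : m = 6 * n) (hn : n = 2 ^ i) (hi : 3 ≤ i) {a : ZMod m} (ha : ¬ 2 ∣ a.val)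
    {w w' g g' : ZMod m} {j l : ℕ} (hj : j < 6) (hl : l < 6) (hjl : j % 3 ≠ l % 3)
    (hw : w = a + ((j : ℕ) : ZMod m) * 𝔫) (hw' : w' = a + ((l : ℕ) : ZMod m) * 𝔫)
    (hg : g = w ∨ g = -w ∨ g = w + 𝔥 ∨ g = -(w + 𝔥)) (hg' : g' = w' ∨ g' = -w' ∨ g' = w' + 𝔥 ∨ g' = -(w' + 𝔥)) :
    g ≠ g' := by
  obtain ⟨e₁, l₁, h₁, rfl⟩ := repr_group₅ hm hj hw hg
  obtain ⟨e₂, l₂, h₂, rfl⟩ := repr_group₅ hm hl hw' hg'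
  intro h
  have := pt₅_injective hm hn hi ha h
  simp only [Prod.mk.injEq] at this
  rw [← this.2] at h₂
  omega

/-! ### Charged groups -/

/-- `d(w) ≠ 0` puts a member of `s` into the group `{±w, ±(w + 3n)}`. [folklore] -/
private theorem exists_mem_group₅ {s : Multiset (ZMod m)} {w : ZMod m}
    (h : ((count w s : ℤ) - count (-w) s) - ((count (w + 𝔥) s : ℤ) - count (-(w + 𝔥)) s) ≠ 0) :
    ∃ g ∈ s, g = w ∨ g = -w ∨ g = w + 𝔥 ∨ g = -(w + 𝔥) := by
  classical
  by_contra hne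
  push Not at hne
  have c0 : ∀ v : ZMod m, (v = w ∨ v = -w ∨ v = w + 𝔥 ∨ v = -(w + 𝔥)) → count v s = 0 := fun v hv ↦
    Multiset.count_eq_zero.mpr fun hvs ↦ by
      obtain ⟨h1, h2, h3, h4⟩ := hne v hvs
      rcases hv with hv | hv | hv | hv
      · exact h1 hv
      · exact h2 hv
      · exact h3 hv
      · exact h4 hv
  apply h
  rw [c0 w (Or.inl rfl), c0 (-w) (Or.inr (Or.inl rfl)), c0 (w + 𝔥) (Or.inr (Or.inr (Or.inl rfl))),
    c0 (-(w + 𝔥)) (Or.inr (Or.inr (Or.inr rfl)))]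
  simp

omit [NeZero m] in
/-- An empty group has `d(w) = 0`. [folklore] -/
private theorem dd_eq_zero_of_forall₅ {s : Multiset (ZMod m)} {w : ZMod m}
    (h : ∀ g, (g = w ∨ g = -w ∨ g = w + 𝔥 ∨ g = -(w + 𝔥)) → g ∉ s) :
    ((count w s : ℤ) - count (-w) s) - ((count (w + 𝔥) s : ℤ) - count (-(w + 𝔥)) s) = 0 := by
  classical
  rw [Multiset.count_eq_zero.mpr (h w (Or.inl rfl)), Multiset.count_eq_zero.mpr (h (-w) (Or.inr (Or.inl rfl))),
    Multiset.count_eq_zero.mpr (h (w + 𝔥) (Or.inr (Or.inr (Or.inl rfl)))),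
    Multiset.count_eq_zero.mpr (h (-(w + 𝔥)) (Or.inr (Or.inr (Or.inr rfl))))]
  simp

/-! ### Odd residues modulo `n = 2ⁱ` -/

/-- For an odd residue `Y` modulo `n = 2ⁱ`, `i ≥ 4`: `cY ≠ 0` for `c ∈ {2, 4, 8, 10}` (reduce modulo `16`). [folklore] -/
private theorem even_mul_ne_zero₅ (hn : n = 2 ^ i) (hi : 4 ≤ i) [NeZero n] {Y : ZMod n} (hY : ¬ 2 ∣ Y.val) {c : ℕ}
    (hc : c = 2 ∨ c = 4 ∨ c = 8 ∨ c = 10) : (c : ZMod n) * Y ≠ 0 := by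
  intro h
  have h16 : 16 ∣ n := sixteen_dvd_n₅ hn hi
  set τ := ZMod.castHom h16 (ZMod 16) with hτ
  have hYτ : (τ Y).val % 2 = 1 := by
    rw [hτ, ZMod.castHom_apply, ZMod.cast_eq_val, ZMod.val_natCast, Nat.mod_mod_of_dvd _ (by norm_num : 2 ∣ 16)]
    omega
  have e := congrArg τ h
  rw [_root_.map_mul, map_natCast, _root_.map_zero] at e
  have key : ∀ a : ZMod 16, a.val % 2 = 1 → ((2 : ℕ) : ZMod 16) * a ≠ 0 ∧ ((4 : ℕ) : ZMod 16) * a ≠ 0 ∧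
      ((8 : ℕ) : ZMod 16) * a ≠ 0 ∧ ((10 : ℕ) : ZMod 16) * a ≠ 0 := by decide
  obtain ⟨k2, k4, k8, k10⟩ := key _ hYτ
  rcases hc with rfl | rfl | rfl | rfl
  · exact k2 e
  · exact k4 e
  · exact k8 e
  · exact k10 e

/-- **A third lives on another hexagon**: for `Y` odd modulo `n = 2ⁱ` (`i ≥ 4`) and `3U = Y`: `U ≠ ±Y`; and if moreover
`3V = U` then `V ≠ ±Y`. [folklore] -/
private theorem third_ne₅ (hn : n = 2 ^ i) (hi : 4 ≤ i) [NeZero n] {U Y : ZMod n} (hY : ¬ 2 ∣ Y.val) (h : 3 * U = Y) :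
    U ≠ Y ∧ U ≠ -Y := by
  constructor
  · rintro rfl
    exact even_mul_ne_zero₅ hn hi hY (c := 2) (Or.inl rfl) (by push_cast; linear_combination h)
  · rintro rfl
    exact even_mul_ne_zero₅ hn hi hY (c := 4) (Or.inr (Or.inl rfl)) (by push_cast; linear_combination -h)

/-- See `third_ne₅`: the ninth. [folklore] -/
private theorem ninth_ne₅ (hn : n = 2 ^ i) (hi : 4 ≤ i) [NeZero n] {U V Y : ZMod n} (hY : ¬ 2 ∣ Y.val) (h : 3 * U = Y)
    (h' : 3 * V = U) : V ≠ Y ∧ V ≠ -Y := by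
  have h9 : 9 * V = Y := by linear_combination 3 * h' + h
  constructor
  · rintro rfl
    exact even_mul_ne_zero₅ hn hi hY (c := 8) (Or.inr (Or.inr (Or.inl rfl))) (by push_cast; linear_combination h9)
  · rintro rfl
    exact even_mul_ne_zero₅ hn hi hY (c := 10) (Or.inr (Or.inr (Or.inr rfl))) (by push_cast; linear_combination -h9)


/-! ### Twin or `γ` at the levels `3·2ᵃ` -/

/-- The core of `twin_or_gamma_twoPowThree`, for a fixed position (`j₁`, `j₂`) of the unit and of the multiple of `3` in the
class `{y, y + 2n, y + 4n}`. [folklore] -/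
private theorem twin_or_gamma_core₅ (hm : m = 6 * n) (hn : n = 2 ^ i) (hi : 4 ≤ i) {s : Multiset (ZMod m)}
    (hs : IsHodgeMultiset s) (hcard : card s = 4) (hpf : ¬ HasPair s) {y : ZMod m} (hy : y ∈ s)
    (hy2 : ¬ 2 ∣ y.val) (hy3 : ¬ 3 ∣ y.val) {j₁ j₂ : ℕ} (hj : (j₁ = 2 ∧ j₂ = 4) ∨ (j₁ = 4 ∧ j₂ = 2))
    (hy'3 : ¬ 3 ∣ (y + ((j₁ : ℕ) : ZMod m) * 𝔫).val) (hx3 : 3 ∣ (y + ((j₂ : ℕ) : ZMod m) * 𝔫).val) :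
    count (y + 3 * 𝔫) s = count y s ∨ s = y ::ₘ (y + 2 * 𝔫) ::ₘ (y + 4 * 𝔫) ::ₘ {-(3 * y)} := by
  classical
  have hn0 : 0 < n := n_pos₅ hn
  haveI : NeZero n := ⟨hn0.ne'⟩
  have hi1 : 1 ≤ i := by omega
  have hi3 : 3 ≤ i := by omega
  have h2 : 2 ∣ n := two_dvd_n₅ hn hi1
  have hnm : n ∣ m := ⟨6, by rw [hm]; ring⟩
  have h6 := six_mul_n₅ hm
  obtain ⟨eh, -⟩ := h_eq_three_mul₅ (m := m) (n := n)
  have hj₁6 : j₁ < 6 := by omega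
  have hcl : ∀ (w : ZMod m) (j : ℕ), (j = 2 ∨ j = 4) →
      (w + ((j : ℕ) : ZMod m) * 𝔫).val % (2 * n) = w.val % (2 * n) := by
    intro w j hj'
    obtain ⟨c2, c4⟩ := mod_two_n_add₅ hm hn0 w
    rcases hj' with rfl | rfl
    · simpa using c2
    · simpa using c4
  have hy'2 : ¬ 2 ∣ (y + ((j₁ : ℕ) : ZMod m) * 𝔫).val := odd_add_mul_n₅ hm h2 hy2 j₁
  have hx2 : ¬ 2 ∣ (y + ((j₂ : ℕ) : ZMod m) * 𝔫).val := odd_add_mul_n₅ hm h2 hy2 j₂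
  have hy'cl := hcl y j₁ (by omega)
  have hxcl := hcl y j₂ (by omega)
  -- pair-freeness at `y`
  have a1 : 1 ≤ count y s := Multiset.one_le_count_iff_mem.mpr hy
  have n0 : count (-y) s = 0 :=
    count_neg_eq_zero_of_not_hasPair₅ hpf (w := y) (by simpa using ne_neg_of_odd₅ hm hn hi3 hy2 0) a1
  have n3 : count (y + 3 * 𝔫) s = 0 ∨ count (-(y + 3 * 𝔫)) s = 0 := by
    simpa using count_or_count_neg_eq_zero₅ hpf (ne_neg_of_odd₅ hm hn hi3 hy2 3)
  have e03 : y + 𝔥 = y + 3 * 𝔫 := by rw [eh]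
  -- the twin when `d(y) = 0`
  by_cases h0 : 𝔡[s, y] = 0
  · left
    rw [e03] at h0
    omega
  -- the class relation at `y` and the third relation at `x = y + j₂ n`
  have R1 := countSub_class_twoThreePower hm (hn₅ hn) hi1 hs hy2 hy3 hy'2 hy'3 hy'cl.symm
  obtain ⟨u, hux, hu2, hu3⟩ := exists_unit_third₅ hm hn hi1 hx2 hx3
  have R2 := countSub_third_twoPowThree hm hn hi1 hs hx2 hy2 hy3 hu2 hu3 hxcl hux
  by_cases hu0 : 𝔡[s, u] = 0
  · -- `d(u) = 0`: both hexagon identities hold at `y`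
    rw [hu0, add_zero, sub_eq_zero] at R2
    have e23 : y + 2 * 𝔫 + 𝔥 = y + 5 * 𝔫 := by rw [eh]; ring
    have e43 : y + 4 * 𝔫 + 𝔥 = y + 𝔫 := by rw [eh]; linear_combination h6
    rcases hj with ⟨rfl, rfl⟩ | ⟨rfl, rfl⟩
    · simp only [Nat.cast_ofNat] at R1 R2
      rw [e03, e23] at R1
      rw [e03, e43] at R2
      exact twin_or_gamma_of_hexagon₅ hm hn hi3 hs hcard hpf hy hy2 R1 (by linear_combination -R1 - R2)
    · simp only [Nat.cast_ofNat] at R1 R2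
      rw [e03, e43] at R1
      rw [e03, e23] at R2
      exact twin_or_gamma_of_hexagon₅ hm hn hi3 hs hcard hpf hy hy2 R2.symm (R2.trans R1)
  · -- `d(u) ≠ 0`: charge propagates to a fifth member
    exfalso
    have hc1 : 𝔡[s, y + ((j₁ : ℕ) : ZMod m) * 𝔫] ≠ 0 := fun h ↦ h0 (R1.trans h)
    obtain ⟨g₁, hg₁s, hg₁⟩ := exists_mem_group₅ hc1
    obtain ⟨g₃, hg₃s, hg₃⟩ := exists_mem_group₅ hu0
    -- the class of `u`: `u' = u + k₁ n` the unit, `x₂ = u + k₂ n` the multiple of `3`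
    obtain ⟨k₁, k₂, hk, hu'3, hx₂3⟩ : ∃ k₁ k₂ : ℕ, ((k₁ = 2 ∧ k₂ = 4) ∨ (k₁ = 4 ∧ k₂ = 2)) ∧
        ¬ 3 ∣ (u + ((k₁ : ℕ) : ZMod m) * 𝔫).val ∧ 3 ∣ (u + ((k₂ : ℕ) : ZMod m) * 𝔫).val := by
      rcases third_class₅ hm hn hu3 with ⟨h2', h4'⟩ | ⟨h2', h4'⟩
      · exact ⟨4, 2, Or.inr ⟨rfl, rfl⟩, by simpa using h4', by simpa using h2'⟩
      · exact ⟨2, 4, Or.inl ⟨rfl, rfl⟩, by simpa using h2', by simpa using h4'⟩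
    have hk₁6 : k₁ < 6 := by omega
    have hk₂6 : k₂ < 6 := by omega
    have hu'2 : ¬ 2 ∣ (u + ((k₁ : ℕ) : ZMod m) * 𝔫).val := odd_add_mul_n₅ hm h2 hu2 k₁
    have hx₂2 : ¬ 2 ∣ (u + ((k₂ : ℕ) : ZMod m) * 𝔫).val := odd_add_mul_n₅ hm h2 hu2 k₂
    have hu'cl := hcl u k₁ (by omega)
    have hx₂cl := hcl u k₂ (by omega)
    have R1u := countSub_class_twoThreePower hm (hn₅ hn) hi1 hs hu2 hu3 hu'2 hu'3 hu'cl.symm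
    have hc4 : 𝔡[s, u + ((k₁ : ℕ) : ZMod m) * 𝔫] ≠ 0 := fun h ↦ hu0 (R1u.trans h)
    obtain ⟨g₄, hg₄s, hg₄⟩ := exists_mem_group₅ hc4
    obtain ⟨v, hvx, hv2, hv3⟩ := exists_unit_third₅ hm hn hi1 hx₂2 hx₂3
    have R2u := countSub_third_twoPowThree hm hn hi1 hs hx₂2 hu2 hu3 hv2 hv3 hx₂cl hvx
    -- reductions modulo `n`: `3U = Y`, `3V = U`, `Y`, `U` odd
    set π := ZMod.castHom hnm (ZMod n) with hπ
    have hπn : π 𝔫 = 0 := castHom_n₅ hnm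
    have hodd : ∀ w : ZMod m, ¬ 2 ∣ w.val → ¬ 2 ∣ (π w).val := fun w hw ↦ by
      rwa [hπ, ZMod.castHom_apply, ZMod.cast_eq_val, ZMod.val_natCast, Nat.dvd_mod_iff h2]
    have hY := hodd y hy2
    have hU := hodd u hu2
    have h3U : 3 * π u = π y := by
      have e := congrArg π hux
      rw [_root_.map_mul, map_ofNat, _root_.map_add, _root_.map_mul, hπn, mul_zero, add_zero] at e
      exact e
    have h3V : 3 * π v = π u := by
      have e := congrArg π hvx
      rw [_root_.map_mul, map_ofNat, _root_.map_add, _root_.map_mul, hπn, mul_zero, add_zero] at e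
      exact e
    obtain ⟨hUY, hUY'⟩ := third_ne₅ hn hi hY h3U
    obtain ⟨hVY, hVY'⟩ := ninth_ne₅ hn hi hY h3U h3V
    obtain ⟨hVU, hVU'⟩ := third_ne₅ hn hi hU h3V
    -- hexagon memberships
    have Hy : ∃ l : ℕ, y = y + ((l : ℕ) : ZMod m) * 𝔫 ∨ y = -(y + ((l : ℕ) : ZMod m) * 𝔫) := ⟨0, Or.inl (by simp)⟩
    have hyG : y = y + ((0 : ℕ) : ZMod m) * 𝔫 ∨ y = -(y + ((0 : ℕ) : ZMod m) * 𝔫) ∨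
        y = y + ((0 : ℕ) : ZMod m) * 𝔫 + 𝔥 ∨ y = -(y + ((0 : ℕ) : ZMod m) * 𝔫 + 𝔥) := Or.inl (by simp)
    have hu0' : u = u + ((0 : ℕ) : ZMod m) * 𝔫 := by simp
    have hv0' : v = v + ((0 : ℕ) : ZMod m) * 𝔫 := by simp
    have Hg₁ := hexagon_of_group₅ (a := y) (j := j₁) rfl hg₁
    have Hg₃ := hexagon_of_group₅ (a := u) (j := 0) hu0' hg₃
    have Hg₄ := hexagon_of_group₅ (a := u) (j := k₁) rfl hg₄
    -- four distinct members
    have d01 : y ≠ g₁ :=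
      ne_of_groups₅ hm hn hi3 hy2 (j := 0) (l := j₁) (by omega) hj₁6 (by omega) rfl rfl hyG hg₁
    have d03 : y ≠ g₃ := ne_of_hexagons₅ hnm hUY hUY' Hy Hg₃
    have d04 : y ≠ g₄ := ne_of_hexagons₅ hnm hUY hUY' Hy Hg₄
    have d13 : g₁ ≠ g₃ := ne_of_hexagons₅ hnm hUY hUY' Hg₁ Hg₃
    have d14 : g₁ ≠ g₄ := ne_of_hexagons₅ hnm hUY hUY' Hg₁ Hg₄
    have d34 : g₃ ≠ g₄ :=
      ne_of_groups₅ hm hn hi3 hu2 (j := 0) (l := k₁) (by omega) hk₁6 (by omega) hu0' rfl hg₃ hg₄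
    have hs4 : s = y ::ₘ g₁ ::ₘ g₃ ::ₘ {g₄} := eq_of_four_mem₅ hcard hy hg₁s hg₃s hg₄s d01 d03 d04 d13 d14 d34
    -- the group of `x₂` is empty, so `d(x₂) = 0` and `d(v) = d(u) ≠ 0`
    have hx₂0 : 𝔡[s, u + ((k₂ : ℕ) : ZMod m) * 𝔫] = 0 := by
      apply dd_eq_zero_of_forall₅
      intro g hg hgs
      have Hg := hexagon_of_group₅ (a := u) (j := k₂) rfl hg
      rw [hs4] at hgs
      simp only [Multiset.mem_cons, Multiset.mem_singleton] at hgs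
      rcases hgs with rfl | rfl | rfl | rfl
      · exact ne_of_hexagons₅ hnm hUY hUY' Hy Hg rfl
      · exact ne_of_hexagons₅ hnm hUY hUY' Hg₁ Hg rfl
      · exact ne_of_groups₅ hm hn hi3 hu2 (j := 0) (l := k₂) (by omega) hk₂6 (by omega) hu0' rfl hg₃ hg rfl
      · exact ne_of_groups₅ hm hn hi3 hu2 (j := k₁) (l := k₂) hk₁6 hk₂6 (by omega) rfl rfl hg₄ hg rfl
    have hc5 : 𝔡[s, v] ≠ 0 := by
      intro hv0
      apply hu0
      linear_combination hx₂0 + hv0 - R2u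
    obtain ⟨g₅, hg₅s, hg₅⟩ := exists_mem_group₅ hc5
    have Hg₅ := hexagon_of_group₅ (a := v) (j := 0) hv0' hg₅
    rw [hs4] at hg₅s
    simp only [Multiset.mem_cons, Multiset.mem_singleton] at hg₅s
    rcases hg₅s with rfl | rfl | rfl | rfl
    · exact ne_of_hexagons₅ hnm hVY hVY' Hy Hg₅ rfl
    · exact ne_of_hexagons₅ hnm hVY hVY' Hg₁ Hg₅ rfl
    · exact ne_of_hexagons₅ hnm hVU hVU' Hg₃ Hg₅ rfl
    · exact ne_of_hexagons₅ hnm hVU hVU' Hg₄ Hg₅ rfl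

/-- **Twin or `γ` at the levels `3·2ᵃ`.** Let `m = 6n = 3·2ᵃ` with `a ≥ 5` (`n = 2ⁱ`, `i ≥ 4`), and let `s` be a PAIR-FREE Hodge
multiset over `ℤ/m` with four members (an indecomposable element of `𝔅²ₘ` up to order, [Shioda1982PicardFermat, §2]). Then
every unit member `y ∈ s` is either TWINNED — `#_{y + m/2} s = #_y s` — or `s = γ_y = {y, y + m/3, y + 2m/3, −3y}`
([Shioda1982PicardFermat, Lemma 1 (b)] / [AokiShioda1983, Thm. (𝔅²ₘ) (ii) c)]). PROOF (this formalisation's): of the class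
`{y, y + 2n, y + 4n}` modulo `2n` let `y′` be the other unit and `x` the multiple of `3`, `u` a unit third of `x`; the class
relation (part I) gives `d(y′) = d(y)`, the third relation gives `d(x) = d(y) − d(u)`. If `d(u) = 0` both hexagon identities
`o(y) − o(y+3n) = o(y+2n) − o(y+5n) = o(y+4n) − o(y+n)` hold and part I's count arithmetic (mass bound over the twelve distinct
points `±(y + jn)`, pair-freeness, zero sum) leaves the twin or `γ_y`. If `d(u) ≠ 0` (then `d(y) ≠ 0` too, else twin) the
groups `{±w, ±(w+3n)}` of `y′`, `u` and of the other unit `u′` of the class of `u` each hold a member of `s`; with `y` these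
are four distinct members (the hexagons `±y + nℤ`, `±u + nℤ` are disjoint as `3u ≡ y (mod n)`), so the group of the multiple
of `3` in the class of `u` is empty and the third relation there charges a unit third `v` of it, whose hexagon is disjoint
from both — a fifth member. Towards [Aoki1983, Thm. C] at the levels `3·2ᵃ` (part V).
[cite: Aoki1983, Thm. C] [cite: Shioda1982PicardFermat, Lemma 1 (b), Prop. 4 (Q′)] -/
theorem twin_or_gamma_twoPowThree (hm : m = 6 * n) (hn : n = 2 ^ i) (hi : 4 ≤ i) {s : Multiset (ZMod m)}
    (hs : IsHodgeMultiset s) (hcard : card s = 4) (hpf : ¬ HasPair s) {y : ZMod m} (hy : y ∈ s)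
    (hy2 : ¬ 2 ∣ y.val) (hy3 : ¬ 3 ∣ y.val) :
    count (y + 3 * 𝔫) s = count y s ∨ s = y ::ₘ (y + 2 * 𝔫) ::ₘ (y + 4 * 𝔫) ::ₘ {-(3 * y)} := by
  rcases third_class₅ hm hn hy3 with ⟨h2', h4'⟩ | ⟨h2', h4'⟩
  · exact twin_or_gamma_core₅ hm hn hi hs hcard hpf hy hy2 hy3 (j₁ := 4) (j₂ := 2) (Or.inr ⟨rfl, rfl⟩)
      (by simpa using h4') (by simpa using h2')
  · exact twin_or_gamma_core₅ hm hn hi hs hcard hpf hy hy2 hy3 (j₁ := 2) (j₂ := 4) (Or.inl ⟨rfl, rfl⟩)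
      (by simpa using h2') (by simpa using h4')


/-! ### The shape of a twinned quadruple: `{y, y + 3n, z, w}` with `z, w` even, not both divisible by `3` -/

/-- `2x = 0` in `ℤ/6n` forces `x ∈ {0, 3n}`. [folklore] -/
private theorem eq_zero_or_eq_h_of_two_mul₅ (hm : m = 6 * n) (hn0 : 0 < n) {x : ZMod m} (h : (2 : ZMod m) * x = 0) :
    x = 0 ∨ x = 𝔥 := by
  have hv : (2 * x.val) % m = 0 := by
    have := congrArg ZMod.val h
    rw [ZMod.val_mul, ZMod.val_zero, show ((2 : ZMod m)).val = 2 by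
      rw [show (2 : ZMod m) = ((2 : ℕ) : ZMod m) by norm_cast, ZMod.val_natCast, Nat.mod_eq_of_lt (by omega)]] at this
    exact this
  have hx := ZMod.val_lt x
  by_cases hlt : 2 * x.val < m
  · left
    rw [Nat.mod_eq_of_lt hlt] at hv
    apply ZMod.val_injective m
    rw [ZMod.val_zero]
    omega
  · right
    apply ZMod.val_injective m
    rw [val_h₅ hm hn0]
    rw [Nat.mod_eq_sub_mod (by omega), Nat.mod_eq_of_lt (by omega)] at hv
    omega

omit [NeZero m] in
/-- Two distinct members of a `4`-multiset leave two more members. [folklore] -/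
private theorem exists_eq_of_two_mem₅ {s : Multiset (ZMod m)} (hcard : card s = 4) {a b : ZMod m} (ha : a ∈ s) (hb : b ∈ s)
    (hab : a ≠ b) : ∃ z w, s = a ::ₘ b ::ₘ {z, w} := by
  have h1 : s = a ::ₘ s.erase a := (Multiset.cons_erase ha).symm
  have hb' : b ∈ s.erase a := (Multiset.mem_erase_of_ne hab.symm).mpr hb
  have h2 : s.erase a = b ::ₘ (s.erase a).erase b := (Multiset.cons_erase hb').symm
  have hcard' : card ((s.erase a).erase b) = 2 := by
    rw [Multiset.card_erase_of_mem hb', Multiset.card_erase_of_mem ha, hcard]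
    rfl
  obtain ⟨z, w, hzw⟩ := Multiset.card_eq_two.mp hcard'
  exact ⟨z, w, by rw [h1, h2, hzw]⟩

omit [NeZero m] in
/-- The sum of `{a, b, z, w}`. [folklore] -/
private theorem sum_four'₅ (a b z w : ZMod m) : (a ::ₘ b ::ₘ ({z, w} : Multiset (ZMod m))).sum = a + b + (z + w) := by
  simp only [Multiset.sum_cons, Multiset.insert_eq_cons, Multiset.sum_singleton]
  ring

/-- **A twinned odd member occurs once.** In a Hodge `4`-multiset over `ℤ/3·2ᵃ` (`a ≥ 4`) an odd member `y` with
`#_{y+3n} = #_y` has `#_y = 1`: otherwise `s = {y, y, y + 3n, y + 3n}` and the zero sum gives `4y = 0`. [folklore] -/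
private theorem count_eq_one_of_twin₅ (hm : m = 6 * n) (hn : n = 2 ^ i) (hi : 3 ≤ i) {s : Multiset (ZMod m)}
    (hs : IsHodgeMultiset s) (hcard : card s = 4) {y : ZMod m} (hy : y ∈ s) (hy2 : ¬ 2 ∣ y.val)
    (htwin : count (y + 3 * 𝔫) s = count y s) : count y s = 1 := by
  classical
  have hn0 := n_pos₅ hn
  have a1 : 1 ≤ count y s := Multiset.one_le_count_iff_mem.mpr hy
  by_contra hne
  have a2 : 2 ≤ count y s := by omega
  have hyB : y ≠ y + 3 * 𝔫 := by simpa using add_mul_n_ne₅ hm hn0 y (j := 0) (l := 3) (by omega) (by omega) (by omega)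
  set T : Multiset (ZMod m) := y ::ₘ y ::ₘ (y + 3 * 𝔫) ::ₘ {y + 3 * 𝔫} with hT
  have hle : T ≤ s := by
    rw [Multiset.le_iff_count]
    intro a
    by_cases hay : a = y
    · subst hay
      have : count a T = 2 := by
        simp only [hT, Multiset.count_cons_self, Multiset.count_cons_of_ne hyB, Multiset.count_singleton, if_neg hyB]
      omega
    · by_cases haB : a = y + 3 * 𝔫
      · subst haB
        have : count (y + 3 * 𝔫) T = 2 := by
          simp only [hT, Multiset.count_cons_of_ne (Ne.symm hyB), Multiset.count_cons_self, Multiset.count_singleton_self]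
        omega
      · have : count a T = 0 := by
          simp only [hT, Multiset.count_cons_of_ne hay, Multiset.count_cons_of_ne haB, Multiset.count_singleton, if_neg haB]
        omega
  have hTs : T = s := Multiset.eq_of_le_of_card_le hle (by rw [hcard, hT]; simp)
  have hsum : s.sum = 0 := hs.1.2
  rw [← hTs, hT] at hsum
  simp only [Multiset.sum_cons, Multiset.sum_singleton] at hsum
  apply natMul_add_ne_zero₅ hm hn hi hy2 (c := 4) (Or.inr rfl) 6
  push_cast
  linear_combination hsum

/-- `3 ∣ ⟨−3z⟩`. [folklore] -/
private theorem three_dvd_val_neg_three_mul₅ (hm : m = 6 * n) (z : ZMod m) : 3 ∣ (-(3 * z)).val := by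
  rw [dvd_val_neg_iff₅ (three_dvd_m₅ hm)]
  rw [show (3 : ZMod m) * z = ((3 * z.val : ℕ) : ZMod m) by push_cast; rw [ZMod.natCast_zmod_val], ZMod.val_natCast]
  exact (Nat.dvd_mod_iff (three_dvd_m₅ hm)).mpr (Dvd.intro _ rfl)

/-- A unit `y` and its twin `y + 3n` do not both lie in `γ_z = {z, z + 2n, z + 4n, −3z}` (`z` odd). [folklore] -/
private theorem not_twin_mem_gamma₅ (hm : m = 6 * n) (hn : n = 2 ^ i) (hi : 3 ≤ i) {y z : ZMod m} (hy3 : ¬ 3 ∣ y.val)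
    (hz2 : ¬ 2 ∣ z.val) (hy : y ∈ (z ::ₘ (z + 2 * 𝔫) ::ₘ (z + 4 * 𝔫) ::ₘ {-(3 * z)} : Multiset (ZMod m)))
    (hB : y + 3 * 𝔫 ∈ (z ::ₘ (z + 2 * 𝔫) ::ₘ (z + 4 * 𝔫) ::ₘ {-(3 * z)} : Multiset (ZMod m))) : False := by
  have hn0 := n_pos₅ hn
  have h6 := six_mul_n₅ hm
  simp only [Multiset.mem_cons, Multiset.mem_singleton] at hy hB
  have A : ∀ j l : ℕ, j < 6 → l < 6 → j ≠ l → z + ((j : ℕ) : ZMod m) * 𝔫 ≠ z + ((l : ℕ) : ZMod m) * 𝔫 :=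
    fun j l hj hl hjl ↦ add_mul_n_ne₅ hm hn0 z hj hl hjl
  have B : ∀ j : ℕ, z + ((j : ℕ) : ZMod m) * 𝔫 ≠ -(3 * z) := fun j e ↦
    natMul_add_ne_zero₅ hm hn hi hz2 (c := 4) (Or.inr rfl) j (by push_cast; linear_combination e)
  have hy' : y ≠ -(3 * z) := fun e ↦ hy3 (by rw [e]; exact three_dvd_val_neg_three_mul₅ hm z)
  rcases hy with h0 | h2 | h4' | h4
  · rw [h0] at hB
    rcases hB with h | h | h | h
    · exact A 3 0 (by omega) (by omega) (by omega) (by simpa using h)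
    · exact A 3 2 (by omega) (by omega) (by omega) (by simpa using h)
    · exact A 3 4 (by omega) (by omega) (by omega) (by simpa using h)
    · exact B 3 (by simpa using h)
  · have e : z + 2 * 𝔫 + 3 * 𝔫 = z + ((5 : ℕ) : ZMod m) * 𝔫 := by push_cast; ring
    rw [h2, e] at hB
    rcases hB with h | h | h | h
    · exact A 5 0 (by omega) (by omega) (by omega) (by simpa using h)
    · exact A 5 2 (by omega) (by omega) (by omega) (by simpa using h)
    · exact A 5 4 (by omega) (by omega) (by omega) (by simpa using h)
    · exact B 5 h
  · have e : z + 4 * 𝔫 + 3 * 𝔫 = z + ((1 : ℕ) : ZMod m) * 𝔫 := by push_cast; linear_combination h6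
    rw [h4', e] at hB
    rcases hB with h | h | h | h
    · exact A 1 0 (by omega) (by omega) (by omega) (by simpa using h)
    · exact A 1 2 (by omega) (by omega) (by omega) (by simpa using h)
    · exact A 1 4 (by omega) (by omega) (by omega) (by simpa using h)
    · exact B 1 h
  · exact hy' h4

/-- In the twinned quadruple `s = {y, y + 3n, z, w}` (`#_y = #_{y+3n} = 1`), the member `z` is NOT a unit. [folklore] -/
private theorem not_unit_of_twin₅ (hm : m = 6 * n) (hn : n = 2 ^ i) (hi : 4 ≤ i)
    {s : Multiset (ZMod m)} (hs : IsHodgeMultiset s) (hcard : card s = 4) (hpf : ¬ HasPair s) {y z w : ZMod m}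
    (hy2 : ¬ 2 ∣ y.val) (hy3 : ¬ 3 ∣ y.val) (hs4 : s = y ::ₘ (y + 3 * 𝔫) ::ₘ {z, w}) (hcy : count y s = 1)
    (hcB : count (y + 3 * 𝔫) s = 1) (hzw : z + w = -(2 * y + 3 * 𝔫)) : 2 ∣ z.val ∨ 3 ∣ z.val := by
  classical
  have hn0 := n_pos₅ hn
  have hi3 : 3 ≤ i := by omega
  have h6 := six_mul_n₅ hm
  by_cases hz2 : 2 ∣ z.val
  · exact Or.inl hz2
  by_cases hz3 : 3 ∣ z.val
  · exact Or.inr hz3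
  exfalso
  have hz : z ∈ s := by rw [hs4]; simp
  have hyB : y ≠ y + 3 * 𝔫 := by simpa using add_mul_n_ne₅ hm hn0 y (j := 0) (l := 3) (by omega) (by omega) (by omega)
  rcases twin_or_gamma_twoPowThree hm hn hi hs hcard hpf hz hz2 hz3 with htw | hγ
  · have hz1 : 1 ≤ count z s := Multiset.one_le_count_iff_mem.mpr hz
    have hmem : z + 3 * 𝔫 ∈ s := Multiset.one_le_count_iff_mem.mp (by omega)
    rw [hs4] at hmem
    simp only [Multiset.mem_cons, Multiset.insert_eq_cons, Multiset.mem_singleton] at hmem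
    rcases hmem with h1 | h2 | h3' | h4
    · have hz' : z = y + 3 * 𝔫 := by linear_combination h1 - h6
      have : 2 ≤ count (y + 3 * 𝔫) s := by
        rw [hs4, Multiset.insert_eq_cons, ← hz', Multiset.count_cons_of_ne (Ne.symm (hz' ▸ hyB)),
          Multiset.count_cons_self, Multiset.count_cons_self]
        omega
      omega
    · have hz' : z = y := add_right_cancel h2
      have : 2 ≤ count y s := by
        rw [hs4, Multiset.insert_eq_cons, ← hz', Multiset.count_cons_self, Multiset.count_cons_of_ne (hz' ▸ hyB),
          Multiset.count_cons_self]
        omega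
      omega
    · exact absurd (by simpa using h3') (by simpa using add_mul_n_ne₅ hm hn0 z (j := 3) (l := 0) (by omega) (by omega) (by omega))
    · have h2yz : (2 : ZMod m) * (y + z) = 0 := by linear_combination hzw + h4 - h6
      rcases eq_zero_or_eq_h_of_two_mul₅ hm hn0 h2yz with h0 | hh
      · have hzy : -y = z := by linear_combination -h0
        have hne : -y ≠ y := by
          rw [hzy]; rintro rfl
          exact absurd hzy.symm (by simpa using add_mul_n_ne_neg₅ hm hn hi3 hy2 0 0)
        exact hpf ⟨y, by rw [hs4]; simp, (Multiset.mem_erase_of_ne hne).mpr (hzy ▸ hz)⟩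
      · have hzy : -(y + 3 * 𝔫) = z := by
          have : (𝔥 : ZMod m) = 3 * 𝔫 := h_eq_three_mul₅.1
          linear_combination -hh - this - h6
        have hne : -(y + 3 * 𝔫) ≠ y + 3 * 𝔫 := by
          simpa using (add_mul_n_ne_neg₅ hm hn hi3 hy2 3 3).symm
        exact hpf ⟨y + 3 * 𝔫, by rw [hs4]; simp, (Multiset.mem_erase_of_ne hne).mpr (hzy ▸ hz)⟩
  · have hym : y ∈ s := Multiset.one_le_count_iff_mem.mp (by omega)
    have hBm : y + 3 * 𝔫 ∈ s := Multiset.one_le_count_iff_mem.mp (by omega)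
    rw [hγ] at hym hBm
    exact not_twin_mem_gamma₅ hm hn hi3 hy3 hz2 hym hBm

/-- **The shape of a twinned quadruple at the levels `3·2ᵃ`.** Let `m = 6n = 3·2ᵃ` (`a ≥ 5`) and let `s` be a pair-free Hodge
`4`-multiset over `ℤ/m` with a unit member `y` that is twinned (`#_{y + 3n} = #_y`; by `twin_or_gamma_twoPowThree` the only
alternative is `s = γ_y`). Then **`s = {y, y + 3n, z, w}` with `z + w = −(2y + 3n)`, `z, w` EVEN, and not both divisible by `3`**
— the input of the twin transfer to level `m/2` (part II, `twin_transfer` with `4 ∣ N`). PROOF: `#_y = 1` (else `4y = 0`); a unit `z`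
would itself be twinned or a `γ` — twinned forces `z ∈ {y, y + 3n}` twice or a pair, and `γ_z ∌ {y, y + 3n}`; so `z, w` are
non-units, `z + w ≡ −2y ≢ 0 (mod 3)` forbids two multiples of `3`, and `z + w ≡ 0 (mod 2)` forbids odd members. This
formalisation's lemma, towards [Aoki1983, Thm. C] at the levels `3·2ᵃ`. [cite: Aoki1983, Thm. C, §9 (III)]
[cite: Shioda1982PicardFermat, Prop. 4 (Q′)] -/
theorem shape_of_twin_twoPowThree (hm : m = 6 * n) (hn : n = 2 ^ i) (hi : 4 ≤ i)
    {s : Multiset (ZMod m)} (hs : IsHodgeMultiset s) (hcard : card s = 4) (hpf : ¬ HasPair s) {y : ZMod m} (hy : y ∈ s)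
    (hy2 : ¬ 2 ∣ y.val) (hy3 : ¬ 3 ∣ y.val) (htwin : count (y + 3 * 𝔫) s = count y s) :
    ∃ z w : ZMod m, s = y ::ₘ (y + 3 * 𝔫) ::ₘ {z, w} ∧ z + w = -(2 * y + 3 * 𝔫) ∧ (2 ∣ z.val ∧ 2 ∣ w.val) ∧
      ¬ (3 ∣ z.val ∧ 3 ∣ w.val) := by
  classical
  have hn0 := n_pos₅ hn
  have hi3 : 3 ≤ i := by omega
  have h2n := two_dvd_n₅ hn (by omega)
  have hcy : count y s = 1 := count_eq_one_of_twin₅ hm hn hi3 hs hcard hy hy2 htwin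
  have hcB : count (y + 3 * 𝔫) s = 1 := by rw [htwin, hcy]
  have hyB : y ≠ y + 3 * 𝔫 := by simpa using add_mul_n_ne₅ hm hn0 y (j := 0) (l := 3) (by omega) (by omega) (by omega)
  obtain ⟨z, w, hs4⟩ := exists_eq_of_two_mem₅ hcard hy (Multiset.one_le_count_iff_mem.mp (by omega)) hyB
  have hsum : s.sum = 0 := hs.1.2
  have hzw : z + w = -(2 * y + 3 * 𝔫) := by
    rw [hs4, sum_four'₅] at hsum
    linear_combination hsum
  have hz := not_unit_of_twin₅ hm hn hi hs hcard hpf hy2 hy3 hs4 hcy hcB hzw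
  have hs4' : s = y ::ₘ (y + 3 * 𝔫) ::ₘ {w, z} := by rw [hs4, Multiset.pair_comm]
  have hw := not_unit_of_twin₅ hm hn hi hs hcard hpf hy2 hy3 hs4' hcy hcB (by rw [add_comm]; exact hzw)
  have h3m := three_dvd_m₅ hm
  have h2m := two_dvd_m₅ hm
  set ρ := ZMod.castHom h3m (ZMod 3) with hρ
  set σ := ZMod.castHom h2m (ZMod 2) with hσ
  have σn : σ 𝔫 = 0 := by rw [map_natCast, ZMod.natCast_eq_zero_iff]; exact h2n
  have ρy : ρ y ≠ 0 := fun e ↦ hy3 ((dvd_val_iff_cast₅ h3m y).mpr e)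
  have eρ := congrArg ρ hzw
  have eσ := congrArg σ hzw
  rw [_root_.map_add, _root_.map_neg, _root_.map_add, _root_.map_mul, _root_.map_mul, map_ofNat, map_ofNat] at eρ
  rw [_root_.map_add, _root_.map_neg, _root_.map_add, _root_.map_mul, _root_.map_mul, σn, map_ofNat, map_ofNat] at eσ
  have not33 : ¬ (3 ∣ z.val ∧ 3 ∣ w.val) := by
    rintro ⟨hz3, hw3⟩
    have key : ∀ a b c d : ZMod 3, c ≠ 0 → a + b = -(2 * c + 3 * d) → ¬ (a = 0 ∧ b = 0) := by decide
    exact key _ _ _ _ ρy eρ ⟨(dvd_val_iff_cast₅ h3m z).mp hz3, (dvd_val_iff_cast₅ h3m w).mp hw3⟩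
  refine ⟨z, w, hs4, hzw, ?_, not33⟩
  have key2 : ∀ a b c : ZMod 2, a + b = -(2 * c + 3 * 0) → a = b := by decide
  have ezw : σ z = σ w := key2 _ _ _ eσ
  by_cases hz2 : 2 ∣ z.val
  · have : σ w = 0 := by rw [← ezw]; exact (dvd_val_iff_cast₅ h2m z).mp hz2
    exact ⟨hz2, (dvd_val_iff_cast₅ h2m w).mpr this⟩
  · exfalso
    have hw2 : ¬ 2 ∣ w.val := fun h ↦ hz2 ((dvd_val_iff_cast₅ h2m z).mpr (by rw [ezw]; exact (dvd_val_iff_cast₅ h2m w).mp h))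
    exact not33 ⟨hz.resolve_left hz2, hw.resolve_left hw2⟩

end TwoPowThree

end Literature.AlgebraicGeometry.Shioda1982
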